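import Literature.AlgebraicGeometry.HodgeTheory.WeilClassesFieldOrthogonalCornersExceptional
import Literature.AlgebraicGeometry.HodgeTheory.WeilClassesFieldDefiniteQuaternionMatricesDecomposable
import HarnessLib

/-!
# Moonen–Zarhin's Criterion (2) for `F ⊆ M_{n+1}(D)`, `D = ℚ(ψ)⟨α, β⟩` a DEFINITE quaternion algebra, on the powers
# `X = A^{n+1}`: THE EXCEPTIONAL ALTERNATIVE («odd exponent ⟹ all non-zero classes of `W_F` exceptional») and the
# PARITY DICHOTOMY (Moonen–Zarhin 1998 §1, Criterion (2), case «Y of Type 3, m ≥ 2», both directions, on the carrier)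

Layer `Literature/AlgebraicGeometry/HodgeTheory`; THEOREMS ONLY — no definition, no named fact, no `sorry` (D-0026, net
debt 0).  Sequel of the seat's `WeilClassesFieldDefiniteQuaternionMatricesDecomposable` (the decomposable half on powers:
«every per-place exponent even ⟹ `W_F ⊗ ℂ ≤ 𝒟ᵐ ⊗ ℂ`») and `WeilClassesFieldOrthogonalCornersExceptional` (the mechanism of
the exceptional half: the reflection `1 - 2Π_π ∈ S(X)(D_X)(ℂ)` along a sub-corner, of determinant `(-1)^{l}`).  This file
runs the mechanism on the powers: it rebuilds the Morita datum of `M_{n+1}(D) ⊗ ℂ` on `H¹(A^{n+1})` together with its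
TYPE-3 ADJOINT STRUCTURE, and proves «some per-place exponent odd ⟹ `W_F ⊗ ℂ ⊓ 𝒟ᵐ ⊗ ℂ = ⊥`», the existence of the
exponents, and the two `iff`s of the dichotomy — for a centre of any degree, and for centre `ℚ` in closed form
(`W_F ⊗ ℂ ≤ 𝒟ᵐ ⊗ ℂ ↔ dim A ∣ m`, `W_F ⊗ ℂ ⊓ 𝒟ᵐ ⊗ ℂ = ⊥ ↔ dim A ∤ m`).

## The print

B. J. J. Moonen, Yu. G. Zarhin, *Weil classes on abelian varieties*, J. reine angew. Math. **496** (1998) 83–92 =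
arXiv:alg-geom/9612017 [MoonenZarhin1998WeilClasses] (held text `paper:arxiv-alg-geom_9612017`), §1, VERBATIM.
Criterion (2) (chunk p0003 L46–L60): «Suppose `X` is isogenous to a power `Y^m` of a simple abelian variety `Y` …
Then either all classes in `W_F` are decomposable, or all non-zero classes in `W_F` are exceptional; this last possibility
occurs precisely in the following cases: `Y` is of Type 3, `m = 1` and `F ⊄ E`, `Y` is of Type 3, `m ≥ 2` and the
integer `2m · [E:ℚ] / [F:ℚ]` is odd, …».  Proof, type 3 with `m ≥ 2` (chunk p0003 L92–L111): «We have `B = M_m(D)`,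
hence `F ⊆ B`.  The centralizer `𝒞` of `B` in `End_E(V_X)` is isomorphic to `M_k(D′)` … `W_F` consists of decomposable
classes if and only if `2m/[F:E]` is even. … an element `g ∈ G_div^{(τ)}(ℂ)` which is not in the connected component …
`Nrd_ℂ(g) = det_ℂ(g) = -1`.  (Recall that `G_div^{(τ)} ≅ O_{2k}`.) … `g` acts on `W_F ⊗ ℂ` as multiplication by
`(-1)^{2m/[F:E]}`, which proves the assertion.»  The Rosati involution (chunk p0002 L87–L90): «With `End⁰(X) = M_m(D)`,
the Rosati involutions `∗` and `†` are related by `α† = (α*ⱼᵢ)`».  Tables 1–2 (chunk p0002 L60–L118): for type 3,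
`B = End⁰(X) = M_m(D)`, `Δ = D`, and `G_div(X)` is the centralizer of `D` in `Sp`, `G_div^{(τ)} ≅ O_{2k}` on `Stand`.
J. S. Milne, *Lefschetz classes on abelian varieties* [Milne1999LefschetzClasses], §1 pp. 642–644, Thm. 3.2, Cor. 4.5 —
the tree's reading of `G_div` as `S(X)(D_X)(ℂ) = unitaryCentralizerGroup` and of «acts trivially on `W_F`» as
`det(u | V_ρ) = 1` (`WeilClassesFieldDecomposableIffLefschetzGroup`).
H. Lange, Ch. Birkenhake, *Complex Abelian Varieties* [LangeBirkenhake1992], Ch. 5 §5: for a totally definite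
quaternion algebra the Rosati (anti-)involution is the quaternion conjugation `x ↦ x̄` on the factors (held PDF p. 138) —
whence `α† = -α`, `β† = -β` for pure quaternions.

## Dictionary

`A` a complex abelian variety, `dim A > 0`, `h ∈ B¹(A) ⊗ ℂ`, `h^{dim A} ≠ 0`, `Q_h` non-degenerate; `X = A^{n+1} = ⨁ A`
with `D_X = Σ πᵢ^* h` (`sumPolarizationClass`); `V = H¹(X(ℂ); ℂ)`; `ψ ∈ End(A)` Rosati-symmetric, `Q(ψ) = 0`, `Q` monic
irreducible (the centre `E = ℚ(ψ)`, places = complex roots `z` of `Q`, `V^{(z)} = ker((⊕ψ)^* - z)`); `α, β` Rosati-skew,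
anticommuting, commuting with `ψ`, `α^{*2} = a(ψ^*)`, `β^{*2} = b(ψ^*)` (`D = E⟨α, β⟩`); «`End⁰(X) = M_{n+1}(D)`» is
the hypothesis that EVERY `χ^*`, `χ ∈ End(X)`, lies in `ℂ⟨(⊕ψ)^*, (⊕α)^*, (⊕β)^*, (πₐ ≫ ι_b)^*⟩`; `F = ℚ(φ)`, `P(φ) = 0`,
`P` monic irreducible of degree `e`, `e · 2m = 2(n+1) dim A = dim V`, `V_ρ = ker(φ^* - ρ)`; `W_F ⊗ ℂ = weilClassesField X φ
P (2m)`, `𝒟ᵐ ⊗ ℂ = divisorClassesSpan X.X X.dim m`.  THE EXPONENT of `ρ` at the place `z`: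
`l_z(ρ) = 2 dim(V_ρ ∩ V^{(z)}) / dim ker(ψ^* - z)` (a natural number, §1; `dim ker(ψ^* - z) = 2 dim A/[E:ℚ]` is
`2 · dim Stand ⊗ line`); in the print `Σ_z l_z(ρ) = 2m[E:ℚ]/[F:ℚ]`.

## What is proved

§1 (centre of any degree):
* **`exists_moritaData_cornerForm_adjoint_biproduct_of_definiteQuaternionOver_diagonal`** — THE MORITA DATUM of
  `M_{n+1}(D) ⊗ ℂ` on `H¹(X)`: `t`, `(x, y, p)` over `Fin (n+1) × Fin 2` inside the pull-back algebra, commuting with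
  `T = (⊕ψ)^*`, `Q_{D_X}(·, t ·)` symmetric and non-degenerate on `pV`, the ADJOINT STRUCTURE
  `Q_{D_X}(x_k v, w) = ε_k Q_{D_X}(v, t y_{σ(k)} w)` (`σ` an involution, `ε_{σk} = -ε_k`), the generators inside
  `ℂ⟨T, x_a y_b⟩`, `T` killed by the nodal polynomial of the roots of `Q`, and the corner dimensions
  `2 dim(pV ∩ V^{(z)}) = dim ker(ψ^* - z)` (the construction of the seat's decomposable file, re-run, plus the adjoints);
* **`weilClassesField_biproduct_inf_divisorClassesSpan_eq_bot_of_forall_mem_adjoin_definiteQuaternionOver_diagonal_of_odd`**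
  — «`End⁰(X) = M_{n+1}(D)`» and `2 dim(V_ρ ∩ V^{(z)})` an ODD multiple of `dim ker(ψ^* - z)` at some root `ρ` and place
  `z` ⟹ `W_F ⊗ ℂ ⊓ 𝒟ᵐ ⊗ ℂ = ⊥`;
* **`exists_two_mul_finrank_eq_mul_of_mem_adjoin_definiteQuaternionOver_diagonal`** — the exponents exist:
  `2 dim(V_ρ ∩ V^{(z)}) = l · dim ker(ψ^* - z)` for `φ^* ∈ ℂ⟨(⊕ψ)^*, (⊕α)^*, (⊕β)^*, (πₐ ≫ ι_b)^*⟩`;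
* **`weilClassesField_biproduct_le_divisorClassesSpan_iff_forall_dvd_…`**,
  **`weilClassesField_biproduct_inf_divisorClassesSpan_eq_bot_iff_exists_odd_…`** — THE DICHOTOMY under
  «`End⁰(X) = M_{n+1}(D)`»: `W_F ⊗ ℂ ≤ 𝒟ᵐ ⊗ ℂ` iff `dim ker(ψ^* - z) ∣ dim(V_ρ ∩ V^{(z)})` for all `ρ`, `z` (all exponents
  even); `W_F ⊗ ℂ ⊓ 𝒟ᵐ ⊗ ℂ = ⊥` iff some exponent is odd.
§2 (centre `ℚ`: `α^{*2} = a`, `β^{*2} = b` non-zero scalars, every `χ^*` in `ℂ⟨(⊕α)^*, (⊕β)^*, (πₐ ≫ ι_b)^*⟩`):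
**`…definiteQuaternion_diagonal_of_not_dvd`** (`dim A ∤ m ⟹ W_F ⊗ ℂ ⊓ 𝒟ᵐ ⊗ ℂ = ⊥`),
**`…_le_divisorClassesSpan_iff_dvd_…`** (`W_F ⊗ ℂ ≤ 𝒟ᵐ ⊗ ℂ ↔ dim A ∣ m`),
**`…_inf_divisorClassesSpan_eq_bot_iff_not_dvd_…`** (`W_F ⊗ ℂ ⊓ 𝒟ᵐ ⊗ ℂ = ⊥ ↔ dim A ∤ m`).

## Relation to the print; scope (honest column)

* «`Y` of Type 3» and «`X ∼ Y^m`, `B = M_m(D)`» are replaced by the PRESENTATION `ψ, α, β` of `D ⊆ End⁰(A)` and the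
  hypothesis that the pull-backs of ALL endomorphisms of `X = A^{n+1}` lie in the algebra generated by the diagonals and
  the matrix units (this is where `End⁰(X) = M_{n+1}(D)` enters; for `A` simple of type 3 with `End⁰(A) = D` it holds,
  which is not proved here); `m′ = n + 1 ≥ 1` is allowed (for `n = 0` the statements concern `F ⊆ D` acting on `A`
  itself; the print lists `m = 1` as a separate row, «`Y` is of Type 3, `m = 1` and `F ⊄ E`», which this file does not
  restate).
* THE PARITY CONDITION is per place and per root; the print's integer is the sum over the places
  (`Σ_z l_z(ρ) = 2m[E:ℚ]/[F:ℚ]`); they agree for `E ⊆ F` or `[E:ℚ] = 1` (§2 is the latter: `l = 2m/dim A = 2(n+1)/e`) —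
  see the honest column of `WeilClassesFieldOrthogonalCornersParity` for the comparison.  Nothing in the Lean statements
  depends on that remark.
* The algebraic group `G_div`, its `π₀` and the reduced norm are replaced by explicit elements of `S(X)(D_X)(ℂ)` acting on
  `H¹` (Milne), as in all the seat's rows; `h` is any class with `h^{dim A} ≠ 0` and `Q_h` non-degenerate.

## References

* [MoonenZarhin1998WeilClasses] B. J. J. Moonen, Yu. G. Zarhin, Weil classes on abelian varieties, J. reine angew.
  Math. 496 (1998) 83–92; arXiv:alg-geom/9612017: §1 Tables 1–2 (chunk p0002 L60–L118), «α† = (α*ⱼᵢ)» (p0002 L87–L90),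
  Criterion (2) and its proof, type 3 (chunk p0003 L46–L60, L92–L111; p0004 L1–L27).
* [Milne1999LefschetzClasses] J. S. Milne, Lefschetz classes on abelian varieties, Duke Math. J. 96 (1999) 639–675,
  §1 pp. 642–644, Thm. 3.2, Cor. 4.5.
* [LangeBirkenhake1992] H. Lange, Ch. Birkenhake, Complex Abelian Varieties, Grundlehren 302 (1992), Ch. 5 §5 (type III:
  the Rosati involution is quaternion conjugation on the factors; held PDF p. 138).
* [McconnellRobson2001] J. C. McConnell, J. C. Robson, Noncommutative Noetherian Rings, GSM 30 (AMS 2001), 3.5.5–3.5.7.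
* [HornJohnson2013] R. A. Horn, C. R. Johnson, Matrix Analysis, 2nd ed. (CUP 2013), §0.4, §1.1, §1.3 and Thm. 1.3.7 ff.

## Provenance

Lane `lit-hodgefound` (Track 2, Layer A), prover seat `lit-hodgefound-p21` (generation 23), row g23-#4 (the instance of
g23-#3 `WeilClassesFieldOrthogonalCornersExceptional` on the powers of g23-#2
`WeilClassesFieldDefiniteQuaternionMatricesDecomposable`).
-/

noncomputable section

open CategoryTheory CategoryTheory.Limits
open Literature.AlgebraicTopology.SingularHomology
open Literature.AlgebraicGeometry.Motives
open Literature.AlgebraicGeometry.VanGeemen1994 (hodgeClassSpan pullbackOne)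
open Literature.AlgebraicGeometry.Milne1999
open Literature.AlgebraicGeometry.Pohlmann1968 (sum_map_π_map_ι map_biproductMap_map_π map_ι_map_π_self)
open Literature.Geometry.Kaehler (lefschetzPow)
open Literature.Barriers.HodgeConjecture (divisorClassesSpan)
open Literature.LinearAlgebra
open Polynomial

namespace Literature.LinearAlgebra

section SkewPairCalc

variable {R : Type*} [Ring R] [Algebra ℂ R] {s t : R}

/-- `p² = p` for `p = ½(1 + s)`, `s² = 1`. [folklore] -/
private theorem sp_half_one_add_mul_self (hs : s * s = 1) :
    ((2:ℂ)⁻¹ • (1 + s)) * ((2:ℂ)⁻¹ • (1 + s)) = (2:ℂ)⁻¹ • (1 + s) := by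
  rw [smul_mul_assoc, mul_smul_comm, smul_smul, mul_add, add_mul, add_mul, one_mul, mul_one, one_mul, hs]
  module

/-- `p t p = 0`. [folklore] -/
private theorem sp_half_one_add_mul_mul_half_one_add (hs : s * s = 1) (hst : s * t = -(t * s)) :
    ((2:ℂ)⁻¹ • (1 + s)) * t * ((2:ℂ)⁻¹ • (1 + s)) = 0 := by
  have hsts : s * t * s = -t := by rw [hst, neg_mul, mul_assoc, hs, mul_one]
  rw [smul_mul_assoc, smul_mul_assoc, mul_smul_comm, smul_smul, add_mul, add_mul, one_mul, mul_add,
    mul_add, mul_one, mul_one, hsts, hst]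
  module

/-- `t p t = q = ½(1 - s)`. [folklore] -/
private theorem sp_mul_half_one_add_mul (ht : t * t = 1) (hst : s * t = -(t * s)) :
    t * ((2:ℂ)⁻¹ • (1 + s)) * t = (2:ℂ)⁻¹ • (1 - s) := by
  have htst : t * s * t = -s := by rw [mul_assoc, hst, mul_neg, ← mul_assoc, ht, one_mul]
  rw [mul_smul_comm, smul_mul_assoc, mul_add, add_mul, mul_one, ht, htst]
  module

/-- `p + q = 1`. [folklore] -/
private theorem sp_half_one_add_add_half_one_sub : (2:ℂ)⁻¹ • (1 + s) + (2:ℂ)⁻¹ • (1 - s) = 1 := by module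

/-- `p - q = s`. [folklore] -/
private theorem sp_half_one_add_sub_half_one_sub : (2:ℂ)⁻¹ • (1 + s) - (2:ℂ)⁻¹ • (1 - s) = s := by module

/-- `t q = p t`. [folklore] -/
private theorem sp_mul_half_one_sub_eq (hst : s * t = -(t * s)) :
    t * ((2:ℂ)⁻¹ • (1 - s)) = ((2:ℂ)⁻¹ • (1 + s)) * t := by
  rw [smul_mul_assoc, mul_smul_comm, add_mul, one_mul, hst, mul_sub, mul_one]
  module

/-- `t = t p + p t`. [folklore] -/
private theorem sp_eq_mul_half_one_add_add (hst : s * t = -(t * s)) :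
    t * ((2:ℂ)⁻¹ • (1 + s)) + ((2:ℂ)⁻¹ • (1 + s)) * t = t := by
  rw [← sp_mul_half_one_sub_eq hst, ← mul_add, sp_half_one_add_add_half_one_sub, mul_one]

/-- An operator commuting with `s` commutes with `½(1 ± s)`. [folklore] -/
private theorem sp_comm_half (L : R) (hLs : L * s = s * L) (ε : R) (hε : ε = s ∨ ε = -s) :
    L * ((2:ℂ)⁻¹ • (1 + ε)) = ((2:ℂ)⁻¹ • (1 + ε)) * L := by
  rcases hε with rfl | rfl
  · rw [mul_smul_comm, smul_mul_assoc, mul_add, add_mul, mul_one, one_mul, hLs]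
  · rw [mul_smul_comm, smul_mul_assoc, mul_add, add_mul, mul_one, one_mul, mul_neg, neg_mul, hLs]

end SkewPairCalc

end Literature.LinearAlgebra

namespace Literature.AlgebraicGeometry.HodgeTheory

/-! ### §0 (private) polynomial and spectral calculus -/

section Aux

variable {M : Type*} [AddCommGroup M] [Module ℂ M]

/-- `L ∘ q(f) = q(g) ∘ L` when `L ∘ f = g ∘ L`. [folklore] -/
private theorem map_aeval_apply_of_semiconj {N : Type*} [AddCommGroup N] [Module ℂ N] (L : M →ₗ[ℂ] N)
    (f : Module.End ℂ M) (g : Module.End ℂ N) (hc : ∀ v, L (f v) = g (L v)) (q : ℂ[X]) (v : M) :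
    L (aeval f q v) = aeval g q (L v) := by
  induction q using Polynomial.induction_on' generalizing v with
  | add p q hp hq => rw [map_add, map_add, LinearMap.add_apply, LinearMap.add_apply, map_add, hp, hq]
  | monomial k c =>
    rw [aeval_monomial, aeval_monomial, Module.End.mul_apply, Module.End.mul_apply,
      Module.algebraMap_end_apply, Module.algebraMap_end_apply, map_smul]
    congr 1
    induction k generalizing v with
    | zero => rw [pow_zero, pow_zero, Module.End.one_apply, Module.End.one_apply]
    | succ k ih => rw [pow_succ, pow_succ, Module.End.mul_apply, Module.End.mul_apply, ih, hc]

/-- `q(T)` commutes with `U` when `T` does. [folklore] -/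
private theorem aeval_comm_of_comm (T U : Module.End ℂ M) (hc : T * U = U * T) (q : ℂ[X]) :
    aeval T q * U = U * aeval T q := by
  refine LinearMap.ext fun v ↦ ?_
  rw [Module.End.mul_apply, Module.End.mul_apply]
  exact (map_aeval_apply_of_semiconj U T T (fun v ↦ by rw [← Module.End.mul_apply, ← hc, Module.End.mul_apply]) q v).symm

/-- A polynomial in a `B`-self-adjoint operator is `B`-self-adjoint, for any bilinear map `B`. [folklore] -/
private theorem pairing_aeval_symm {W : Type*} [AddCommGroup W] [Module ℂ W] (B : M →ₗ[ℂ] M →ₗ[ℂ] W)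
    (T : Module.End ℂ M) (hT : ∀ v w, B (T v) w = B v (T w)) (q : ℂ[X]) (v w : M) :
    B (aeval T q v) w = B v (aeval T q w) := by
  induction q using Polynomial.induction_on' generalizing v w with
  | add p q hp hq => rw [map_add, LinearMap.add_apply, LinearMap.add_apply, map_add, LinearMap.add_apply, map_add, hp, hq]
  | monomial k c =>
    rw [aeval_monomial, Module.End.mul_apply, Module.End.mul_apply, Module.algebraMap_end_apply,
      Module.algebraMap_end_apply, map_smul, LinearMap.smul_apply, map_smul]
    congr 1
    induction k generalizing v w with
    | zero => rw [pow_zero, Module.End.one_apply, Module.End.one_apply]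
    | succ k ih =>
      conv_lhs => rw [pow_succ', Module.End.mul_apply]
      rw [hT, ih, ← Module.End.mul_apply, ← pow_succ]

/-- Functional calculus on an eigen-idempotent: `T P = z P ⟹ q(T) P = q(z) P`. [folklore] -/
private theorem aeval_mul_eq_eval_smul {T P : Module.End ℂ M} {z : ℂ} (hTP : T * P = z • P) (q : ℂ[X]) :
    aeval T q * P = q.eval z • P := by
  induction q using Polynomial.induction_on' with
  | add p q hp hq => rw [map_add, add_mul, hp, hq, eval_add, add_smul]
  | monomial k c =>
    have hk : ∀ k : ℕ, T ^ k * P = z ^ k • P := by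
      intro k
      induction k with
      | zero => rw [pow_zero, pow_zero, one_mul, one_smul]
      | succ k ih => rw [pow_succ, mul_assoc, hTP, mul_smul_comm, ih, smul_smul, pow_succ, mul_comm z]
    rw [aeval_monomial, eval_monomial, mul_assoc, hk, Algebra.algebraMap_eq_smul_one, smul_mul_assoc, one_mul,
      smul_smul]

/-- If `Σ_z P_z = 1`, two operators agreeing on every `P_z` are equal. [folklore] -/
private theorem eq_of_forall_mul_proj_eq {κ : Type*} {s : Finset κ} {P : κ → Module.End ℂ M}
    (hPsum : ∑ z ∈ s, P z = 1) {L L' : Module.End ℂ M} (hL : ∀ z ∈ s, L * P z = L' * P z) : L = L' := by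
  rw [← mul_one L, ← hPsum, Finset.mul_sum, ← mul_one L', ← hPsum, Finset.mul_sum]
  exact Finset.sum_congr rfl hL

/-- `(Σ_w c_w ℓ_w)(z) = c_z` for the Lagrange basis `ℓ_w` of a finite `s ∋ z`. [folklore] -/
private theorem eval_sum_C_mul_basis {s : Finset ℂ} (c : ℂ → ℂ) {z : ℂ} (hz : z ∈ s) :
    (∑ w ∈ s, C (c w) * Lagrange.basis s id w).eval z = c z := by
  classical
  rw [Polynomial.eval_finsetSum, Finset.sum_eq_single_of_mem z hz fun w _ hwz ↦ ?_]
  · have h1 : (Lagrange.basis s id z).eval z = 1 := Lagrange.eval_basis_self (v := id) (Set.injOn_id _) hz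
    rw [eval_mul, eval_C, h1, mul_one]
  · have h0 : (Lagrange.basis s id w).eval z = 0 := Lagrange.eval_basis_of_ne (v := id) hwz hz
    rw [eval_mul, eval_C, h0, mul_zero]

/-- **The normalisation.** If `S² = q(T)`, `S` commutes with `T`, `T` has simple spectrum `s` and `q(z) = c_z² ≠ 0` on
`s`, then `R = Σ_z c_z⁻¹ P_z ∈ ℂ[T]` satisfies `(S R)² = 1` and `R · (Σ_z c_z P_z) = 1`. [folklore] -/
private theorem sq_normaliser {T S : Module.End ℂ M} {s : Finset ℂ} (hs : s.Nonempty)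
    (hTs : aeval T (Lagrange.nodal s id) = 0) {q : ℂ[X]} (hS2 : S * S = aeval T q) (hTS : T * S = S * T)
    {c : ℂ → ℂ} (hc : ∀ z ∈ s, q.eval z = c z * c z) (hc0 : ∀ z ∈ s, c z ≠ 0) :
    S * aeval T (∑ w ∈ s, C ((c w)⁻¹) * Lagrange.basis s id w) *
        (S * aeval T (∑ w ∈ s, C ((c w)⁻¹) * Lagrange.basis s id w)) = 1 ∧
      aeval T (∑ w ∈ s, C ((c w)⁻¹) * Lagrange.basis s id w) * aeval T (∑ w ∈ s, C (c w) * Lagrange.basis s id w) = 1 := by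
  classical
  obtain ⟨hPsum, -, -, hTP⟩ := aeval_lagrange_basis_spectral T s hs hTs
  set R := aeval T (∑ w ∈ s, C ((c w)⁻¹) * Lagrange.basis s id w) with hRdef
  set R' := aeval T (∑ w ∈ s, C (c w) * Lagrange.basis s id w) with hR'def
  have hRP : ∀ z ∈ s, R * aeval T (Lagrange.basis s id z) = (c z)⁻¹ • aeval T (Lagrange.basis s id z) :=
    fun z hz ↦ by rw [hRdef, aeval_mul_eq_eval_smul (hTP z hz), eval_sum_C_mul_basis (fun w ↦ (c w)⁻¹) hz]
  have hR'P : ∀ z ∈ s, R' * aeval T (Lagrange.basis s id z) = c z • aeval T (Lagrange.basis s id z) :=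
    fun z hz ↦ by rw [hR'def, aeval_mul_eq_eval_smul (hTP z hz), eval_sum_C_mul_basis c hz]
  have hRS : R * S = S * R := aeval_comm_of_comm T S hTS _
  refine ⟨?_, ?_⟩
  · have hSS : S * R * (S * R) = aeval T q * (R * R) := by
      rw [mul_assoc, ← mul_assoc R S, hRS, mul_assoc, ← mul_assoc S S, hS2]
    refine eq_of_forall_mul_proj_eq hPsum fun z hz ↦ ?_
    rw [hSS, one_mul, mul_assoc, mul_assoc, hRP z hz, mul_smul_comm, hRP z hz, smul_smul, mul_smul_comm,
      aeval_mul_eq_eval_smul (hTP z hz), smul_smul, hc z hz,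
      show (c z)⁻¹ * (c z)⁻¹ * (c z * c z) = 1 by field_simp [hc0 z hz], one_smul]
  · refine eq_of_forall_mul_proj_eq hPsum fun z hz ↦ ?_
    rw [one_mul, mul_assoc, hR'P z hz, mul_smul_comm, hRP z hz, smul_smul, mul_inv_cancel₀ (hc0 z hz), one_smul]

end Aux

/-- The complex roots of a monic integer polynomial irreducible over `ℚ` are simple and non-empty, with nodal
polynomial the polynomial itself. [folklore] -/
private theorem nodal_roots_toFinset {Q : Polynomial ℤ} (hQm : Q.Monic)
    (hQirr : Irreducible (Q.map (Int.castRingHom ℚ))) :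
    Lagrange.nodal (Q.map (Int.castRingHom ℂ)).roots.toFinset id = Q.map (Int.castRingHom ℂ) ∧
      (Q.map (Int.castRingHom ℂ)).roots.toFinset.Nonempty := by
  classical
  have hQc : Q.map (Int.castRingHom ℂ) = (Q.map (Int.castRingHom ℚ)).map (algebraMap ℚ ℂ) := by
    rw [Polynomial.map_map, RingHom.ext_int ((algebraMap ℚ ℂ).comp (Int.castRingHom ℚ)) (Int.castRingHom ℂ)]
  have hsep : (Q.map (Int.castRingHom ℂ)).Separable := by
    rw [hQc]
    exact hQirr.separable.map
  have hmon : (Q.map (Int.castRingHom ℂ)).Monic := hQm.map _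
  have hnodup : (Q.map (Int.castRingHom ℂ)).roots.Nodup := Polynomial.nodup_roots hsep
  refine ⟨?_, ?_⟩
  · have hsplit := (IsAlgClosed.splits (Q.map (Int.castRingHom ℂ))).eq_prod_roots_of_monic hmon
    rw [Lagrange.nodal_eq, ← Multiset.toFinset_eq hnodup, Finset.prod_mk]
    exact hsplit.symm
  · have hdeg : (Q.map (Int.castRingHom ℂ)).degree ≠ 0 := by
      have h1 : 0 < (Q.map (Int.castRingHom ℚ)).natDegree :=
        Polynomial.natDegree_pos_iff_degree_pos.2 (Polynomial.degree_pos_of_irreducible hQirr)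
      rw [hQm.natDegree_map] at h1
      intro h0
      rw [Polynomial.degree_eq_natDegree hmon.ne_zero, hQm.natDegree_map] at h0
      exact h1.ne' (by exact_mod_cast h0)
    obtain ⟨z, hz⟩ := IsAlgClosed.exists_root _ hdeg
    exact ⟨z, Multiset.mem_toFinset.2 ((Polynomial.mem_roots hmon.ne_zero).2 hz)⟩

/-! ### §1 THE MORITA DATUM OF `M_{n+1}(D) ⊗ ℂ` ON `H¹(A^{n+1})` WITH ITS TYPE-3 ADJOINT STRUCTURE, and «odd exponent
⟹ `W_F` exceptional» on powers -/

section DefiniteQuaternionMatrices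

variable {A : AbelianVariety ℂ} {h : complexBetti A.X 2} {n : ℕ} {ψ α β : A ⟶ A} {qa qb : ℂ[X]}
  {φ : ⨁ (fun _ : Fin (n + 1) => A) ⟶ ⨁ (fun _ : Fin (n + 1) => A)} {P Q : Polynomial ℤ} {e m : ℕ}

set_option maxHeartbeats 400000 in
/-- **THE MORITA DATUM OF `M_{n+1}(D) ⊗ ℂ` ON `H¹(A^{n+1}(ℂ); ℂ)`, WITH ITS ORTHOGONAL CORNER AND TYPE-3 ADJOINT
STRUCTURE.**  Let `A` be a complex abelian variety of positive dimension with `h ∈ B¹(A) ⊗ ℂ`, `h^{dim A} ≠ 0`, `Q_h`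
non-degenerate; `ψ ∈ End(A)` Rosati-symmetric with `Q(ψ) = 0` (`Q ∈ ℤ[T]` monic irreducible: the totally real centre
`E = ℚ(ψ)`); `α, β ∈ End(A)` ROSATI-SKEW, anticommuting, commuting with `ψ^*`, `α^{*2} = a(ψ^*)`, `β^{*2} = b(ψ^*)`
with `a, b` non-vanishing at the complex roots of `Q` (`D = E⟨α, β⟩` a definite quaternion algebra so presented).  On
`X = A^{n+1}` with the product polarization `D_X = Σ πᵢ^* h` there are: a corner operator `t` and a Morita datum
`(x, y, p)` over `ι = Fin (n+1) × Fin 2` inside the pull-back algebra `ℂ⟨χ^* : χ ∈ End(X)⟩` (`yᵢ xⱼ = δᵢⱼ p`,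
`Σ xᵢ yᵢ = 1`), commuting with `T = (⊕ψ)^*`, with `Q_{D_X}(·, t ·)` symmetric and non-degenerate on `pV`; an
involution `σ` of `ι` and signs `ε` (`ε_{σk} = -ε_k`) with the ADJOINT STRUCTURE `Q_{D_X}(x_k v, w) = ε_k Q_{D_X}(v,
t y_{σ(k)} w)` («`α† = (α*ⱼᵢ)`» for `M_m(D)` with `∗` the quaternion conjugation: `x_{(i,0)}† = t y_{(i,1)}`,
`x_{(i,1)}† = -t y_{(i,0)}`); the generators `(⊕ψ)^*, (⊕α)^*, (⊕β)^*, (πₐ ≫ ι_b)^*` inside `ℂ⟨T, x_a y_b⟩`; `T` killed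
by the nodal polynomial of the complex roots of `Q`; and the CORNER DIMENSIONS `2 · dim(pV ∩ ker(T - z)) =
dim ker(ψ^* - z)` at every complex root `z` of `Q` (the print's `Stand ⊗ W^{(τ)}`, `dim Stand = 2k`).  Construction:
the seat's `WeilClassesFieldDefiniteQuaternionMatricesDecomposable` (normalised skew pair `S = (⊕α)^* a(T)^{-1/2}`,
`T′ = (⊕β)^* b(T)^{-1/2}`, `p′ = ½(1 + S)`, `x′ = (p′, T′p′)`, `y′ = (p′, p′T′)`, `x_{(i,c)} = e_{i0} x′_c`,
`y_{(i,c)} = y′_c e_{0i}`, `p = e_{00} p′`, `t = T′`), here re-run and completed by the adjoint structure.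
[cite: MoonenZarhin1998WeilClasses, §1 «With End⁰(X) = M_m(D), the Rosati involutions ∗ and † are related by α† = (α*ⱼᵢ)» (chunk p0002 L87–L90); Tables 1–2 and proof of Criterion (2), type 3 (chunk p0002 L104–L118, p0003 L92–L111)]
[cite: LangeBirkenhake1992, Ch. 5 §5 (type III: the Rosati involution is quaternion conjugation; PDF p. 138)]
[cite: McconnellRobson2001, 3.5.5–3.5.7] [cite: HornJohnson2013, §1.1 and Thm. 1.3.7 ff.] -/
theorem exists_moritaData_cornerForm_adjoint_biproduct_of_definiteQuaternionOver_diagonal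
    (hA : 0 < A.dim) (hh : h ∈ hodgeClassSpan A.dim A.X 1) (htop : lefschetzPow h (A.dim - 1) 2 h ≠ 0)
    (hnd : ∀ x : complexBetti A.X 1, (∀ y, polarizationPairingOne A.X h (A.dim - 1) x y = 0) → x = 0)
    (hψsym : ∀ v w : complexBetti A.X 1, polarizationPairingOne A.X h (A.dim - 1) (pullbackOne A ψ v) w =
      polarizationPairingOne A.X h (A.dim - 1) v (pullbackOne A ψ w))
    (hQm : Q.Monic) (hQirr : Irreducible (Q.map (Int.castRingHom ℚ)))
    (hψQ : Polynomial.eval₂ (Int.castRingHom (CategoryTheory.End A)) (ψ : CategoryTheory.End A) Q = 0)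
    (hα2 : pullbackOne A α * pullbackOne A α = aeval (pullbackOne A ψ) qa)
    (hqa : ∀ z : ℂ, (Q.map (Int.castRingHom ℂ)).IsRoot z → qa.eval z ≠ 0)
    (hβ2 : pullbackOne A β * pullbackOne A β = aeval (pullbackOne A ψ) qb)
    (hqb : ∀ z : ℂ, (Q.map (Int.castRingHom ℂ)).IsRoot z → qb.eval z ≠ 0)
    (hanti : pullbackOne A α * pullbackOne A β = -(pullbackOne A β * pullbackOne A α))
    (hαskew : ∀ v w : complexBetti A.X 1, polarizationPairingOne A.X h (A.dim - 1) (pullbackOne A α v) w =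
      -polarizationPairingOne A.X h (A.dim - 1) v (pullbackOne A α w))
    (hβskew : ∀ v w : complexBetti A.X 1, polarizationPairingOne A.X h (A.dim - 1) (pullbackOne A β v) w =
      -polarizationPairingOne A.X h (A.dim - 1) v (pullbackOne A β w))
    (hψα : pullbackOne A ψ * pullbackOne A α = pullbackOne A α * pullbackOne A ψ)
    (hψβ : pullbackOne A ψ * pullbackOne A β = pullbackOne A β * pullbackOne A ψ) :
    ∃ (t p : Module.End ℂ (complexBetti (⨁ (fun _ : Fin (n + 1) => A)).X 1)) (x y : Fin (n + 1) × Fin 2 → Module.End ℂ (complexBetti (⨁ (fun _ : Fin (n + 1) => A)).X 1))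
      (σ : Fin (n + 1) × Fin 2 → Fin (n + 1) × Fin 2) (ε : Fin (n + 1) × Fin 2 → ℂ),
      (∀ i j, y i * x j = if i = j then p else 0) ∧ (∑ i, x i * y i = 1) ∧
      (∀ v w, polarizationPairingOne (⨁ (fun _ : Fin (n + 1) => A)).X (sumPolarizationClass (fun _ : Fin (n + 1) => A) (fun _ => h)) ((⨁ (fun _ : Fin (n + 1) => A)).dim - 1) v (t w) =
        polarizationPairingOne (⨁ (fun _ : Fin (n + 1) => A)).X (sumPolarizationClass (fun _ : Fin (n + 1) => A) (fun _ => h)) ((⨁ (fun _ : Fin (n + 1) => A)).dim - 1) w (t v)) ∧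
      (∀ v ∈ LinearMap.range p, (∀ w ∈ LinearMap.range p,
        polarizationPairingOne (⨁ (fun _ : Fin (n + 1) => A)).X (sumPolarizationClass (fun _ : Fin (n + 1) => A) (fun _ => h)) ((⨁ (fun _ : Fin (n + 1) => A)).dim - 1) v (t w) = 0) → v = 0) ∧
      Function.Involutive σ ∧ (∀ k, ε (σ k) = -ε k) ∧
      (∀ k v w, polarizationPairingOne (⨁ (fun _ : Fin (n + 1) => A)).X (sumPolarizationClass (fun _ : Fin (n + 1) => A) (fun _ => h)) ((⨁ (fun _ : Fin (n + 1) => A)).dim - 1) (x k v) w =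
        ε k • polarizationPairingOne (⨁ (fun _ : Fin (n + 1) => A)).X (sumPolarizationClass (fun _ : Fin (n + 1) => A) (fun _ => h)) ((⨁ (fun _ : Fin (n + 1) => A)).dim - 1) v (t (y (σ k) w))) ∧
      (∀ i, pullbackOne (⨁ (fun _ : Fin (n + 1) => A)) (biproduct.map fun _ : Fin (n + 1) => ψ) * x i = x i * pullbackOne (⨁ (fun _ : Fin (n + 1) => A)) (biproduct.map fun _ : Fin (n + 1) => ψ)) ∧
      (∀ i, pullbackOne (⨁ (fun _ : Fin (n + 1) => A)) (biproduct.map fun _ : Fin (n + 1) => ψ) * y i = y i * pullbackOne (⨁ (fun _ : Fin (n + 1) => A)) (biproduct.map fun _ : Fin (n + 1) => ψ)) ∧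
      (pullbackOne (⨁ (fun _ : Fin (n + 1) => A)) (biproduct.map fun _ : Fin (n + 1) => ψ) * t = t * pullbackOne (⨁ (fun _ : Fin (n + 1) => A)) (biproduct.map fun _ : Fin (n + 1) => ψ)) ∧
      (∀ i, x i ∈ Algebra.adjoin ℂ (Set.range fun χ : (⨁ (fun _ : Fin (n + 1) => A)) ⟶ (⨁ (fun _ : Fin (n + 1) => A)) ↦ pullbackOne (⨁ (fun _ : Fin (n + 1) => A)) χ)) ∧
      (∀ i, y i ∈ Algebra.adjoin ℂ (Set.range fun χ : (⨁ (fun _ : Fin (n + 1) => A)) ⟶ (⨁ (fun _ : Fin (n + 1) => A)) ↦ pullbackOne (⨁ (fun _ : Fin (n + 1) => A)) χ)) ∧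
      (t ∈ Algebra.adjoin ℂ (Set.range fun χ : (⨁ (fun _ : Fin (n + 1) => A)) ⟶ (⨁ (fun _ : Fin (n + 1) => A)) ↦ pullbackOne (⨁ (fun _ : Fin (n + 1) => A)) χ)) ∧
      (insert (pullbackOne (⨁ (fun _ : Fin (n + 1) => A)) (biproduct.map fun _ : Fin (n + 1) => ψ))
        (insert (pullbackOne (⨁ (fun _ : Fin (n + 1) => A)) (biproduct.map fun _ : Fin (n + 1) => α))
          (insert (pullbackOne (⨁ (fun _ : Fin (n + 1) => A)) (biproduct.map fun _ : Fin (n + 1) => β))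
            (Set.range fun ab : Fin (n + 1) × Fin (n + 1) ↦ pullbackOne (⨁ (fun _ : Fin (n + 1) => A))
              (biproduct.π (fun _ : Fin (n + 1) => A) ab.1 ≫ biproduct.ι (fun _ : Fin (n + 1) => A) ab.2)))) ⊆
        (Algebra.adjoin ℂ (insert (pullbackOne (⨁ (fun _ : Fin (n + 1) => A)) (biproduct.map fun _ : Fin (n + 1) => ψ))
          (Set.range fun st : (Fin (n + 1) × Fin 2) × (Fin (n + 1) × Fin 2) ↦ x st.1 * y st.2)) :
            Set (Module.End ℂ (complexBetti (⨁ (fun _ : Fin (n + 1) => A)).X 1)))) ∧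
      (aeval (pullbackOne (⨁ (fun _ : Fin (n + 1) => A)) (biproduct.map fun _ : Fin (n + 1) => ψ)) (Lagrange.nodal (Q.map (Int.castRingHom ℂ)).roots.toFinset id) = 0) ∧
      (∀ z : ℂ, (Q.map (Int.castRingHom ℂ)).IsRoot z →
        2 * Module.finrank ℂ ↥(LinearMap.range p ⊓ (pullbackOne (⨁ (fun _ : Fin (n + 1) => A)) (biproduct.map fun _ : Fin (n + 1) => ψ)).eigenspace z) =
          Module.finrank ℂ ↥((pullbackOne A ψ).eigenspace z)) := by
  classical
  obtain ⟨hhX, -, hndX⟩ := sumPolarizationClass_hypotheses (fun _ : Fin (n + 1) => A) (fun _ => h)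
      (fun _ => hA) (fun _ => hh) (fun _ => htop) (fun _ => hnd)
  -- notation (`(⨁ (fun _ : Fin (n + 1) => A)) = A^{n+1}` is spelled out: `set` would shadow `φ`)
  haveI : Module.Finite ℂ (complexBetti (⨁ (fun _ : Fin (n + 1) => A)).X 1) :=
    abelianVarietyCohomologyExteriorH1_holds.finite_one _
  set D := sumPolarizationClass (fun _ : Fin (n + 1) => A) (fun _ => h) with hDdef
  set T : Module.End ℂ (complexBetti (⨁ (fun _ : Fin (n + 1) => A)).X 1) := pullbackOne (⨁ (fun _ : Fin (n + 1) => A)) (biproduct.map fun _ : Fin (n + 1) => ψ) with hTdef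
  set Sa : Module.End ℂ (complexBetti (⨁ (fun _ : Fin (n + 1) => A)).X 1) := pullbackOne (⨁ (fun _ : Fin (n + 1) => A)) (biproduct.map fun _ : Fin (n + 1) => α) with hSadef
  set Sb : Module.End ℂ (complexBetti (⨁ (fun _ : Fin (n + 1) => A)).X 1) := pullbackOne (⨁ (fun _ : Fin (n + 1) => A)) (biproduct.map fun _ : Fin (n + 1) => β) with hSbdef
  set U : Fin (n + 1) → Fin (n + 1) → Module.End ℂ (complexBetti (⨁ (fun _ : Fin (n + 1) => A)).X 1) := fun a b ↦
    pullbackOne (⨁ (fun _ : Fin (n + 1) => A)) (biproduct.π (fun _ : Fin (n + 1) => A) a ≫ biproduct.ι (fun _ : Fin (n + 1) => A) b) with hUdef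
  -- the ambient algebra: the pull-back algebra `𝔄 = ℂ⟨χ^* : χ ∈ End((⨁ (fun _ : Fin (n + 1) => A)))⟩`
  set 𝔄 : Subalgebra ℂ (Module.End ℂ (complexBetti (⨁ (fun _ : Fin (n + 1) => A)).X 1)) :=
    Algebra.adjoin ℂ (Set.range fun χ : (⨁ (fun _ : Fin (n + 1) => A)) ⟶ (⨁ (fun _ : Fin (n + 1) => A)) ↦ pullbackOne (⨁ (fun _ : Fin (n + 1) => A)) χ) with h𝔄def
  have hU : ∀ a b c d, U a b * U c d = if b = c then U a d else 0 := fun a b c d ↦ pullbackOne_π_comp_ι_mul a b c d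
  have hUsum : ∑ a, U a a = 1 := sum_pullbackOne_π_comp_ι
  have hUadj : ∀ a b (v w : complexBetti (⨁ (fun _ : Fin (n + 1) => A)).X 1), polarizationPairingOne (⨁ (fun _ : Fin (n + 1) => A)).X D ((⨁ (fun _ : Fin (n + 1) => A)).dim - 1) (U a b v) w =
      polarizationPairingOne (⨁ (fun _ : Fin (n + 1) => A)).X D ((⨁ (fun _ : Fin (n + 1) => A)).dim - 1) v (U b a w) :=
    fun a b v w ↦ polarizationPairingOne_pullbackOne_π_comp_ι hA hh htop hnd a b v w
  have hU𝔄 : ∀ a b, U a b ∈ 𝔄 := fun a b ↦ Algebra.subset_adjoin ⟨_, rfl⟩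
  have hT𝔄 : T ∈ 𝔄 := Algebra.subset_adjoin ⟨_, rfl⟩
  have hSa𝔄 : Sa ∈ 𝔄 := Algebra.subset_adjoin ⟨_, rfl⟩
  have hSb𝔄 : Sb ∈ 𝔄 := Algebra.subset_adjoin ⟨_, rfl⟩
  -- the diagonals: `T` symmetric, `Sa`, `Sb` skew
  have hT_symm : T ∈ symmetricPullbackSpan (⨁ (fun _ : Fin (n + 1) => A)) D :=
    pullbackOne_biproductMap_mem_symmetricPullbackSpan (fun _ : Fin (n + 1) => A) (fun _ => h) (fun _ => hA)
      (fun _ => ψ) (fun _ => hψsym)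
  have hSa_skew : ∀ v w : complexBetti (⨁ (fun _ : Fin (n + 1) => A)).X 1, polarizationPairingOne (⨁ (fun _ : Fin (n + 1) => A)).X D ((⨁ (fun _ : Fin (n + 1) => A)).dim - 1) (Sa v) w =
      -polarizationPairingOne (⨁ (fun _ : Fin (n + 1) => A)).X D ((⨁ (fun _ : Fin (n + 1) => A)).dim - 1) v (Sa w) :=
    fun v w ↦ polarizationPairingOne_biproductMap_const_of_skew hA α hαskew v w
  have hSb_skew : ∀ v w : complexBetti (⨁ (fun _ : Fin (n + 1) => A)).X 1, polarizationPairingOne (⨁ (fun _ : Fin (n + 1) => A)).X D ((⨁ (fun _ : Fin (n + 1) => A)).dim - 1) (Sb v) w =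
      -polarizationPairingOne (⨁ (fun _ : Fin (n + 1) => A)).X D ((⨁ (fun _ : Fin (n + 1) => A)).dim - 1) v (Sb w) :=
    fun v w ↦ polarizationPairingOne_biproductMap_const_of_skew hA β hβskew v w
  have hSanti : Sa * Sb = -(Sb * Sa) := pullbackOne_biproductMap_const_mul_eq_neg hanti
  have hTSa : T * Sa = Sa * T := pullbackOne_biproductMap_const_comm hψα
  have hTSb : T * Sb = Sb * T := pullbackOne_biproductMap_const_comm hψβ
  have hTU : ∀ c d, T * U c d = U c d * T := fun c d ↦ pullbackOne_biproductMap_const_mul_π_comp_ι ψ c d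
  have hSaU : ∀ c d, Sa * U c d = U c d * Sa := fun c d ↦ pullbackOne_biproductMap_const_mul_π_comp_ι α c d
  have hSbU : ∀ c d, Sb * U c d = U c d * Sb := fun c d ↦ pullbackOne_biproductMap_const_mul_π_comp_ι β c d
  -- the square relations `(⊕γ)^{*2} = q((⊕ψ)^*)` transfer slotwise
  have hsq : ∀ {γ : A ⟶ A} {q : ℂ[X]}, pullbackOne A γ * pullbackOne A γ = aeval (pullbackOne A ψ) q →
      pullbackOne (⨁ (fun _ : Fin (n + 1) => A)) (biproduct.map fun _ : Fin (n + 1) => γ) * pullbackOne (⨁ (fun _ : Fin (n + 1) => A)) (biproduct.map fun _ : Fin (n + 1) => γ) =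
        aeval T q := by
    intro γ q hγ
    refine LinearMap.ext fun v ↦ ?_
    rw [pullbackOne_biproductMap_const_mul_apply, hγ]
    conv_rhs => rw [← sum_map_π_map_ι (fun _ : Fin (n + 1) => A) v, map_sum]
    refine Finset.sum_congr rfl fun c _ ↦ ?_
    exact (map_aeval_apply_of_semiconj (complexBetti.map (biproduct.π (fun _ : Fin (n + 1) => A) c).hom.hom.hom 1).hom
      (pullbackOne A ψ) T (fun w ↦ (map_biproductMap_map_π (fun _ : Fin (n + 1) => A) (fun _ => ψ) c 1 w).symm) q _)
  have hSa2 : Sa * Sa = aeval T qa := hsq hα2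
  have hSb2 : Sb * Sb = aeval T qb := hsq hβ2
  have hTQ : aeval T (Q.map (Int.castRingHom ℂ)) = 0 := by
    have hψQ' := aeval_hom_complexBetti_map_one_eq_zero hψQ
    refine LinearMap.ext fun v ↦ ?_
    rw [LinearMap.zero_apply, ← sum_map_π_map_ι (fun _ : Fin (n + 1) => A) v, map_sum]
    refine Finset.sum_eq_zero fun c _ ↦ ?_
    have key := map_aeval_apply_of_semiconj (complexBetti.map (biproduct.π (fun _ : Fin (n + 1) => A) c).hom.hom.hom 1).hom
      (pullbackOne A ψ) T (fun w ↦ (map_biproductMap_map_π (fun _ : Fin (n + 1) => A) (fun _ => ψ) c 1 w).symm)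
      (Q.map (Int.castRingHom ℂ)) (complexBetti.map (biproduct.ι (fun _ : Fin (n + 1) => A) c).hom.hom.hom 1 v)
    rw [hψQ', LinearMap.zero_apply, map_zero] at key
    exact key.symm
  set s : Finset ℂ := (Q.map (Int.castRingHom ℂ)).roots.toFinset with hsdef
  obtain ⟨hnodal, hsne⟩ := nodal_roots_toFinset hQm hQirr
  have hTnodal : aeval T (Lagrange.nodal s id) = 0 := by rw [hsdef, hnodal, hTQ]
  have hmem_s : ∀ z ∈ s, (Q.map (Int.castRingHom ℂ)).IsRoot z := fun z hz ↦ by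
    rw [hsdef] at hz
    exact (Polynomial.mem_roots (hQm.map _).ne_zero).1 (Multiset.mem_toFinset.1 hz)
  -- square roots of `a(z)`, `b(z)` at the places `z`
  have hσex : ∀ z : ℂ, ∃ σ : ℂ, qa.eval z = σ * σ := fun z ↦ IsAlgClosed.exists_eq_mul_self _
  have hτex : ∀ z : ℂ, ∃ τ : ℂ, qb.eval z = τ * τ := fun z ↦ IsAlgClosed.exists_eq_mul_self _
  choose σ hσ using hσex
  choose τ hτ using hτex
  have hσ0 : ∀ z ∈ s, σ z ≠ 0 := fun z hz h0 ↦ hqa z (hmem_s z hz) (by rw [hσ z, h0, mul_zero])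
  have hτ0 : ∀ z ∈ s, τ z ≠ 0 := fun z hz h0 ↦ hqb z (hmem_s z hz) (by rw [hτ z, h0, mul_zero])
  -- the normalised pair `S = (⊕α)^* a(T)^{-1/2}`, `T' = (⊕β)^* b(T)^{-1/2}`
  obtain ⟨hS2, hRaRa'⟩ := sq_normaliser hsne hTnodal hSa2 hTSa (fun z hz ↦ hσ z) hσ0
  obtain ⟨hT2, hRbRb'⟩ := sq_normaliser hsne hTnodal hSb2 hTSb (fun z hz ↦ hτ z) hτ0
  set Ra : Module.End ℂ (complexBetti (⨁ (fun _ : Fin (n + 1) => A)).X 1) := aeval T (∑ w ∈ s, C ((σ w)⁻¹) * Lagrange.basis s id w) with hRadef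
  set Ra' : Module.End ℂ (complexBetti (⨁ (fun _ : Fin (n + 1) => A)).X 1) := aeval T (∑ w ∈ s, C (σ w) * Lagrange.basis s id w) with hRa'def
  set Rb : Module.End ℂ (complexBetti (⨁ (fun _ : Fin (n + 1) => A)).X 1) := aeval T (∑ w ∈ s, C ((τ w)⁻¹) * Lagrange.basis s id w) with hRbdef
  set Rb' : Module.End ℂ (complexBetti (⨁ (fun _ : Fin (n + 1) => A)).X 1) := aeval T (∑ w ∈ s, C (τ w) * Lagrange.basis s id w) with hRb'def
  have hRaSa : Ra * Sa = Sa * Ra := aeval_comm_of_comm T Sa hTSa _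
  have hRaSb : Ra * Sb = Sb * Ra := aeval_comm_of_comm T Sb hTSb _
  have hRbSa : Rb * Sa = Sa * Rb := aeval_comm_of_comm T Sa hTSa _
  have hRbSb : Rb * Sb = Sb * Rb := aeval_comm_of_comm T Sb hTSb _
  have hRbT : Rb * T = T * Rb := aeval_comm_of_comm T T rfl _
  have hRaT : Ra * T = T * Ra := aeval_comm_of_comm T T rfl _
  have hRaRb : Ra * Rb = Rb * Ra := aeval_comm_of_comm T Rb hRbT.symm _
  have hRaU : ∀ c d, Ra * U c d = U c d * Ra := fun c d ↦ aeval_comm_of_comm T (U c d) (hTU c d) _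
  have hRbU : ∀ c d, Rb * U c d = U c d * Rb := fun c d ↦ aeval_comm_of_comm T (U c d) (hTU c d) _
  have hRa_adj : ∀ v w : complexBetti (⨁ (fun _ : Fin (n + 1) => A)).X 1, polarizationPairingOne (⨁ (fun _ : Fin (n + 1) => A)).X D ((⨁ (fun _ : Fin (n + 1) => A)).dim - 1) (Ra v) w =
      polarizationPairingOne (⨁ (fun _ : Fin (n + 1) => A)).X D ((⨁ (fun _ : Fin (n + 1) => A)).dim - 1) v (Ra w) := fun v w ↦ pairing_aeval_symm _ T hT_symm.2 _ v w
  have hRb_adj : ∀ v w : complexBetti (⨁ (fun _ : Fin (n + 1) => A)).X 1, polarizationPairingOne (⨁ (fun _ : Fin (n + 1) => A)).X D ((⨁ (fun _ : Fin (n + 1) => A)).dim - 1) (Rb v) w =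
      polarizationPairingOne (⨁ (fun _ : Fin (n + 1) => A)).X D ((⨁ (fun _ : Fin (n + 1) => A)).dim - 1) v (Rb w) := fun v w ↦ pairing_aeval_symm _ T hT_symm.2 _ v w
  have hCT : ∀ q : ℂ[X], aeval T q ∈ 𝔄 := fun q ↦
    Algebra.adjoin_le (Set.singleton_subset_iff.2 hT𝔄) (Polynomial.aeval_mem_adjoin_singleton ℂ T)
  set S : Module.End ℂ (complexBetti (⨁ (fun _ : Fin (n + 1) => A)).X 1) := Sa * Ra with hSdef
  set T' : Module.End ℂ (complexBetti (⨁ (fun _ : Fin (n + 1) => A)).X 1) := Sb * Rb with hT'def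
  have hcm : ∀ {L V W : Module.End ℂ (complexBetti (⨁ (fun _ : Fin (n + 1) => A)).X 1)}, L * V = V * L → L * W = W * L →
      L * (V * W) = V * W * L := fun h1 h2 ↦ by rw [← mul_assoc, h1, mul_assoc, h2, ← mul_assoc]
  have hST : S * T' = -(T' * S) := by
    have e1 : S * T' = Sa * Sb * (Ra * Rb) := by
      rw [hSdef, hT'def, mul_assoc, ← mul_assoc Ra Sb, hRaSb, mul_assoc, ← mul_assoc Sa Sb]
    have e2 : T' * S = Sb * Sa * (Ra * Rb) := by
      rw [hSdef, hT'def, mul_assoc, ← mul_assoc Rb Sa, hRbSa, mul_assoc, ← mul_assoc Sb Sa, hRaRb]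
    rw [e1, e2, hSanti, neg_mul]
  have hS_skew : ∀ v w : complexBetti (⨁ (fun _ : Fin (n + 1) => A)).X 1, polarizationPairingOne (⨁ (fun _ : Fin (n + 1) => A)).X D ((⨁ (fun _ : Fin (n + 1) => A)).dim - 1) (S v) w =
      -polarizationPairingOne (⨁ (fun _ : Fin (n + 1) => A)).X D ((⨁ (fun _ : Fin (n + 1) => A)).dim - 1) v (S w) := by
    intro v w
    rw [hSdef, Module.End.mul_apply, hSa_skew, hRa_adj, ← Module.End.mul_apply, hRaSa]
  have hT'_skew : ∀ v w : complexBetti (⨁ (fun _ : Fin (n + 1) => A)).X 1, polarizationPairingOne (⨁ (fun _ : Fin (n + 1) => A)).X D ((⨁ (fun _ : Fin (n + 1) => A)).dim - 1) (T' v) w =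
      -polarizationPairingOne (⨁ (fun _ : Fin (n + 1) => A)).X D ((⨁ (fun _ : Fin (n + 1) => A)).dim - 1) v (T' w) := by
    intro v w
    rw [hT'def, Module.End.mul_apply, hSb_skew, hRb_adj, ← Module.End.mul_apply, hRbSb]
  have hS_mem : S ∈ 𝔄 := Subalgebra.mul_mem _ hSa𝔄 (hCT _)
  have hT'_mem : T' ∈ 𝔄 := Subalgebra.mul_mem _ hSb𝔄 (hCT _)
  have hS2' : S * S = (1:ℂ) • 1 := by rw [one_smul]; exact hS2
  have hT2' : T' * T' = (1:ℂ) • 1 := by rw [one_smul]; exact hT2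
  have hTS : T * S = S * T := hcm hTSa hRaT.symm
  have hTT' : T * T' = T' * T := hcm hTSb hRbT.symm
  have hUS : ∀ c d, U c d * S = S * U c d := fun c d ↦ hcm (hSaU c d).symm (hRaU c d).symm
  have hUT' : ∀ c d, U c d * T' = T' * U c d := fun c d ↦ hcm (hSbU c d).symm (hRbU c d).symm
  -- the `2 × 2` block of the normalised SKEW pair `S, T'`: `p' = ½(1 + S)`, `q' = ½(1 - S)`, units `(p', T'p')`,
  -- `(p', p'T')`, ISOTROPIC corner `p'V` with partner `q'V = T'(p'V)` and corner operator `t' = T'`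
  have hQskew : ∀ v w : complexBetti (⨁ (fun _ : Fin (n + 1) => A)).X 1, polarizationPairingOne (⨁ (fun _ : Fin (n + 1) => A)).X D ((⨁ (fun _ : Fin (n + 1) => A)).dim - 1) v w =
      -polarizationPairingOne (⨁ (fun _ : Fin (n + 1) => A)).X D ((⨁ (fun _ : Fin (n + 1) => A)).dim - 1) w v := fun v w ↦ by
    have h0 := polarizationPairingOne_self D ((⨁ (fun _ : Fin (n + 1) => A)).dim - 1) (v + w)
    simp only [map_add, LinearMap.add_apply, polarizationPairingOne_self, zero_add, add_zero] at h0
    exact eq_neg_of_add_eq_zero_right h0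
  set p' : Module.End ℂ (complexBetti (⨁ (fun _ : Fin (n + 1) => A)).X 1) := (2:ℂ)⁻¹ • (1 + S) with hp'def
  set q' : Module.End ℂ (complexBetti (⨁ (fun _ : Fin (n + 1) => A)).X 1) := (2:ℂ)⁻¹ • (1 - S) with hq'def
  have hq'def' : q' = (2:ℂ)⁻¹ • (1 + -S) := by rw [hq'def, sub_eq_add_neg]
  have hpp : p' * p' = p' := sp_half_one_add_mul_self hS2
  have hptp : p' * T' * p' = 0 := sp_half_one_add_mul_mul_half_one_add hS2 hST
  have htpt : T' * p' * T' = q' := sp_mul_half_one_add_mul hT2 hST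
  have hpq : p' + q' = 1 := sp_half_one_add_add_half_one_sub
  have htq : T' * q' = p' * T' := sp_mul_half_one_sub_eq hST
  have hqp : q' * p' = 0 := by
    rw [← htpt, mul_assoc, mul_assoc, ← mul_assoc p' T' p', hptp, mul_zero]
  have hpq0 : p' * q' = 0 := by
    have hq : q' = 1 - p' := by rw [← hpq, add_sub_cancel_left]
    rw [hq, mul_sub, mul_one, hpp, sub_self]
  have hp'adj : ∀ v w : complexBetti (⨁ (fun _ : Fin (n + 1) => A)).X 1, polarizationPairingOne (⨁ (fun _ : Fin (n + 1) => A)).X D ((⨁ (fun _ : Fin (n + 1) => A)).dim - 1) (p' v) w =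
      polarizationPairingOne (⨁ (fun _ : Fin (n + 1) => A)).X D ((⨁ (fun _ : Fin (n + 1) => A)).dim - 1) v (q' w) := by
    intro v w
    simp only [hp'def, hq'def, LinearMap.smul_apply, LinearMap.add_apply, LinearMap.sub_apply, Module.End.one_apply,
      map_add, map_sub, map_smul, LinearMap.smul_apply, hS_skew]
    rw [sub_eq_add_neg]
  let x' : Fin 2 → Module.End ℂ (complexBetti (⨁ (fun _ : Fin (n + 1) => A)).X 1) := ![p', T' * p']
  let y' : Fin 2 → Module.End ℂ (complexBetti (⨁ (fun _ : Fin (n + 1) => A)).X 1) := ![p', p' * T']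
  have hyx' : ∀ i j, y' i * x' j = if i = j then p' else 0 := by
    have h01 : p' * (T' * p') = 0 := by rw [← mul_assoc, hptp]
    have h11 : p' * T' * (T' * p') = p' := by rw [mul_assoc, ← mul_assoc T', hT2, one_mul, hpp]
    intro i j
    fin_cases i <;> fin_cases j <;> simp [x', y', hpp, h01, hptp, h11]
  have hsum' : ∑ i, x' i * y' i = 1 := by
    rw [Fin.sum_univ_two]
    change p' * p' + T' * p' * (p' * T') = 1
    rw [hpp, mul_assoc, ← mul_assoc p' p', hpp, ← mul_assoc, htpt, hpq]
  have ht'symm : ∀ v w : complexBetti (⨁ (fun _ : Fin (n + 1) => A)).X 1,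
      polarizationPairingOne (⨁ (fun _ : Fin (n + 1) => A)).X D ((⨁ (fun _ : Fin (n + 1) => A)).dim - 1) v (T' w) = polarizationPairingOne (⨁ (fun _ : Fin (n + 1) => A)).X D ((⨁ (fun _ : Fin (n + 1) => A)).dim - 1) w (T' v) := by
    intro v w
    rw [hQskew w (T' v), hT'_skew, neg_neg]
  have ht'nd : ∀ v ∈ LinearMap.range p',
      (∀ w ∈ LinearMap.range p', polarizationPairingOne (⨁ (fun _ : Fin (n + 1) => A)).X D ((⨁ (fun _ : Fin (n + 1) => A)).dim - 1) v (T' w) = 0) → v = 0 := by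
    intro v hv h0
    obtain ⟨v', rfl⟩ := hv
    refine hndX _ fun z ↦ ?_
    have hz : z = p' z + q' z := by rw [← LinearMap.add_apply, hpq, Module.End.one_apply]
    have h1 : polarizationPairingOne (⨁ (fun _ : Fin (n + 1) => A)).X D ((⨁ (fun _ : Fin (n + 1) => A)).dim - 1) (p' v') (p' z) = 0 := by
      rw [hp'adj, ← Module.End.mul_apply, hqp, LinearMap.zero_apply, map_zero]
    have h2 : polarizationPairingOne (⨁ (fun _ : Fin (n + 1) => A)).X D ((⨁ (fun _ : Fin (n + 1) => A)).dim - 1) (p' v') (q' z) = 0 := by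
      have e : q' z = T' (p' (T' z)) := by rw [← htpt]; rfl
      rw [e]
      exact h0 _ ⟨T' z, rfl⟩
    rw [hz, map_add, h1, h2, add_zero]
  -- commutation of the units and of `T` with the block
  have hcommS : ∀ L : Module.End ℂ (complexBetti (⨁ (fun _ : Fin (n + 1) => A)).X 1), L * S = S * L → L * T' = T' * L →
      L * p' = p' * L ∧ L * q' = q' * L ∧ (∀ k, L * x' k = x' k * L) ∧ (∀ k, L * y' k = y' k * L) := by
    intro L hLS hLT
    have hLp : L * p' = p' * L := sp_comm_half L hLS S (Or.inl rfl)
    have hLq : L * q' = q' * L := by rw [hq'def']; exact sp_comm_half L hLS (-S) (Or.inr rfl)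
    refine ⟨hLp, hLq, fun k ↦ ?_, fun k ↦ ?_⟩
    · fin_cases k
      · exact hLp
      · change L * (T' * p') = T' * p' * L
        rw [← mul_assoc, hLT, mul_assoc, hLp, ← mul_assoc]
    · fin_cases k
      · exact hLp
      · change L * (p' * T') = p' * T' * L
        rw [← mul_assoc, hLp, mul_assoc, hLT, ← mul_assoc]
  have hUx' : ∀ c d k, U c d * x' k = x' k * U c d := fun c d k ↦ (hcommS _ (hUS c d) (hUT' c d)).2.2.1 k
  have hUy' : ∀ c d k, U c d * y' k = y' k * U c d := fun c d k ↦ (hcommS _ (hUS c d) (hUT' c d)).2.2.2 k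
  have hUp' : ∀ c d, U c d * p' = p' * U c d := fun c d ↦ (hcommS _ (hUS c d) (hUT' c d)).1
  have hTx' : ∀ k, T * x' k = x' k * T := fun k ↦ (hcommS _ hTS hTT').2.2.1 k
  have hTy' : ∀ k, T * y' k = y' k * T := fun k ↦ (hcommS _ hTS hTT').2.2.2 k
  have hTp' : T * p' = p' * T := (hcommS _ hTS hTT').1
  -- `S, T'` lie in the span of the units
  have hST' : ({S, T'} : Set (Module.End ℂ (complexBetti (⨁ (fun _ : Fin (n + 1) => A)).X 1))) ⊆
      Submodule.span ℂ (Set.range fun ij : Fin 2 × Fin 2 ↦ x' ij.1 * y' ij.2) := by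
    have hSx : S = p' * p' - T' * p' * (p' * T') := by
      rw [hpp, mul_assoc, ← mul_assoc p' p', hpp, ← mul_assoc, htpt, hp'def, hq'def, sp_half_one_add_sub_half_one_sub]
    have hTx : T' = T' * p' * p' + p' * (p' * T') := by
      rw [mul_assoc T' p' p', hpp, ← mul_assoc p' p' T', hpp, hp'def, sp_eq_mul_half_one_add_add hST]
    refine Set.insert_subset_iff.2 ⟨?_, Set.singleton_subset_iff.2 ?_⟩
    · rw [hSx]
      exact Submodule.sub_mem _ (Submodule.subset_span ⟨(0, 0), rfl⟩) (Submodule.subset_span ⟨(1, 1), rfl⟩)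
    · rw [hTx]
      exact Submodule.add_mem _ (Submodule.subset_span ⟨(1, 0), rfl⟩) (Submodule.subset_span ⟨(0, 1), rfl⟩)
  have hp'𝔄 : p' ∈ 𝔄 := Subalgebra.smul_mem _ (Subalgebra.add_mem _ (Subalgebra.one_mem _) hS_mem) _
  have hx'𝔄 : ∀ k, x' k ∈ 𝔄 := by
    intro k
    fin_cases k
    · exact hp'𝔄
    · exact Subalgebra.mul_mem _ hT'_mem hp'𝔄
  have hy'𝔄 : ∀ k, y' k ∈ 𝔄 := by
    intro k
    fin_cases k
    · exact hp'𝔄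
    · exact Subalgebra.mul_mem _ hp'𝔄 hT'_mem
  -- the combined Morita datum over `Fin (n+1) × Fin 2`
  let x : Fin (n + 1) × Fin 2 → Module.End ℂ (complexBetti (⨁ (fun _ : Fin (n + 1) => A)).X 1) := fun ic ↦ U ic.1 0 * x' ic.2
  let y : Fin (n + 1) × Fin 2 → Module.End ℂ (complexBetti (⨁ (fun _ : Fin (n + 1) => A)).X 1) := fun ic ↦ y' ic.2 * U 0 ic.1
  let p : Module.End ℂ (complexBetti (⨁ (fun _ : Fin (n + 1) => A)).X 1) := U 0 0 * p'
  have hyx : ∀ ic jd, y ic * x jd = if ic = jd then p else 0 := by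
    rintro ⟨i, c⟩ ⟨j, d⟩
    change y' c * U 0 i * (U j 0 * x' d) = if (i, c) = (j, d) then U 0 0 * p' else 0
    rw [mul_assoc, ← mul_assoc (U 0 i), hU]
    by_cases hij : i = j
    · subst hij
      rw [if_pos rfl, hUx', ← mul_assoc, hyx']
      by_cases hcd : c = d
      · subst hcd
        rw [if_pos rfl, if_pos rfl]
        exact (comm_idem_of_moritaData hyx' hsum' (fun k ↦ hUx' 0 0 k) (fun k ↦ hUy' 0 0 k)).symm
      · rw [if_neg hcd, zero_mul, if_neg fun h ↦ hcd (Prod.mk.inj h).2]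
    · rw [if_neg hij, zero_mul, mul_zero, if_neg fun h ↦ hij (Prod.mk.inj h).1]
  have hsumxy : ∑ ic, x ic * y ic = 1 := by
    rw [Fintype.sum_prod_type]
    change ∑ i, ∑ c, U i 0 * x' c * (y' c * U 0 i) = 1
    have e1 : ∀ i c, U i 0 * x' c * (y' c * U 0 i) = U i 0 * (x' c * y' c) * U 0 i := fun i c ↦ by
      rw [mul_assoc, mul_assoc, mul_assoc]
    simp_rw [e1, ← Finset.sum_mul, ← Finset.mul_sum, hsum', mul_one, hU, if_true]
    exact hUsum
  have hxmem : ∀ ic, x ic ∈ 𝔄 := fun ic ↦ Subalgebra.mul_mem _ (hU𝔄 _ _) (hx'𝔄 _)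
  have hymem : ∀ ic, y ic ∈ 𝔄 := fun ic ↦ Subalgebra.mul_mem _ (hy'𝔄 _) (hU𝔄 _ _)
  have hTx : ∀ ic, T * x ic = x ic * T := by
    rintro ⟨i, c⟩
    change T * (U i 0 * x' c) = U i 0 * x' c * T
    rw [← mul_assoc, hTU, mul_assoc, hTx', ← mul_assoc]
  have hTy : ∀ ic, T * y ic = y ic * T := by
    rintro ⟨i, c⟩
    change T * (y' c * U 0 i) = y' c * U 0 i * T
    rw [← mul_assoc, hTy', mul_assoc, hTU, ← mul_assoc]
  -- non-degeneracy of `Q(·, t' ·)` on the corner `pV = e_{00} p' V ⊆ p'V`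
  have htnd : ∀ v ∈ LinearMap.range p,
      (∀ w ∈ LinearMap.range p, polarizationPairingOne (⨁ (fun _ : Fin (n + 1) => A)).X D ((⨁ (fun _ : Fin (n + 1) => A)).dim - 1) v (T' w) = 0) → v = 0 := by
    intro v hv h0
    obtain ⟨v', rfl⟩ := hv
    have hv1 : U 0 0 ((U 0 0 * p') v') = (U 0 0 * p') v' := by
      rw [← Module.End.mul_apply, ← mul_assoc, hU, if_pos rfl]
    refine ht'nd _ ⟨U 0 0 v', by rw [← Module.End.mul_apply, ← hUp']⟩ fun w hw ↦ ?_
    obtain ⟨w', rfl⟩ := hw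
    -- `Q(v, t' p' w') = Σ_a Q(v, t' e_{aa} p' w') = Q(v, t' e_{00} p' w') = 0`
    have hsplit : p' w' = ∑ a, U a a (p' w') := by rw [← LinearMap.sum_apply, hUsum, Module.End.one_apply]
    have hterm : ∀ a, a ≠ 0 →
        polarizationPairingOne (⨁ (fun _ : Fin (n + 1) => A)).X D ((⨁ (fun _ : Fin (n + 1) => A)).dim - 1) ((U 0 0 * p') v') (T' (U a a (p' w'))) = 0 := by
      intro a ha
      calc polarizationPairingOne (⨁ (fun _ : Fin (n + 1) => A)).X D ((⨁ (fun _ : Fin (n + 1) => A)).dim - 1) ((U 0 0 * p') v') (T' (U a a (p' w')))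
          = polarizationPairingOne (⨁ (fun _ : Fin (n + 1) => A)).X D ((⨁ (fun _ : Fin (n + 1) => A)).dim - 1) ((U 0 0 * p') v') (U a a (T' (p' w'))) := by
            rw [← Module.End.mul_apply T', ← hUT', Module.End.mul_apply (U a a) T']
        _ = polarizationPairingOne (⨁ (fun _ : Fin (n + 1) => A)).X D ((⨁ (fun _ : Fin (n + 1) => A)).dim - 1) (U a a ((U 0 0 * p') v')) (T' (p' w')) := by rw [hUadj]
        _ = 0 := by
            rw [← hv1, ← Module.End.mul_apply (U a a), hU, if_neg ha, LinearMap.zero_apply,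
              LinearMap.map_zero₂]
    rw [hsplit, map_sum, map_sum, Finset.sum_eq_single (0 : Fin (n + 1)) (fun a _ ha ↦ hterm a ha)
      fun h0' ↦ absurd (Finset.mem_univ _) h0']
    exact h0 _ ⟨w', by rw [Module.End.mul_apply]⟩
  -- the generators lie in `ℂ⟨T, x y⟩`
  have hW_unit : ∀ c d, U c d ∈ Submodule.span ℂ
      (Set.range fun st : (Fin (n + 1) × Fin 2) × (Fin (n + 1) × Fin 2) ↦ x st.1 * y st.2) := by
    intro c d
    have e1 : U c d = ∑ k, x (c, k) * y (d, k) := by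
      change U c d = ∑ k, U c 0 * x' k * (y' k * U 0 d)
      have e2 : ∀ k, U c 0 * x' k * (y' k * U 0 d) = U c 0 * (x' k * y' k) * U 0 d := fun k ↦ by
        rw [mul_assoc, mul_assoc, mul_assoc]
      simp_rw [e2, ← Finset.sum_mul, ← Finset.mul_sum, hsum', mul_one, hU, if_true]
    rw [e1]
    exact Submodule.sum_mem _ fun k _ ↦ Submodule.subset_span ⟨((c, k), (d, k)), rfl⟩
  have hW_pair : ∀ k l, x' k * y' l ∈ Submodule.span ℂ
      (Set.range fun st : (Fin (n + 1) × Fin 2) × (Fin (n + 1) × Fin 2) ↦ x st.1 * y st.2) := by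
    intro k l
    have e1 : x' k * y' l = ∑ i, x (i, k) * y (i, l) := by
      change x' k * y' l = ∑ i, U i 0 * x' k * (y' l * U 0 i)
      have e2 : ∀ i, U i 0 * x' k * (y' l * U 0 i) = x' k * y' l * (U i 0 * U 0 i) := fun i ↦ by
        rw [hUx', mul_assoc, mul_assoc, ← mul_assoc (U i 0), hUy', mul_assoc]
      simp_rw [e2, hU, if_true, ← Finset.mul_sum, hUsum, mul_one]
    rw [e1]
    exact Submodule.sum_mem _ fun i _ ↦ Submodule.subset_span ⟨((i, k), (i, l)), rfl⟩
  have hSa_eq : Sa = S * Ra' := by rw [hSdef, mul_assoc, hRaRa', mul_one]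
  have hSb_eq : Sb = T' * Rb' := by rw [hT'def, mul_assoc, hRbRb', mul_one]
  have hgens : insert T (insert Sa (insert Sb (Set.range fun ab : Fin (n + 1) × Fin (n + 1) ↦ U ab.1 ab.2))) ⊆
      (Algebra.adjoin ℂ (insert T (Set.range fun st : (Fin (n + 1) × Fin 2) × (Fin (n + 1) × Fin 2) ↦
        x st.1 * y st.2)) : Set (Module.End ℂ (complexBetti (⨁ (fun _ : Fin (n + 1) => A)).X 1))) := by
    have hWR : Submodule.span ℂ (Set.range fun st : (Fin (n + 1) × Fin 2) × (Fin (n + 1) × Fin 2) ↦ x st.1 * y st.2) ≤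
        Subalgebra.toSubmodule (Algebra.adjoin ℂ (insert T (Set.range
          fun st : (Fin (n + 1) × Fin 2) × (Fin (n + 1) × Fin 2) ↦ x st.1 * y st.2))) :=
      Submodule.span_le.2 fun g hg ↦ Algebra.subset_adjoin (Set.mem_insert_of_mem _ hg)
    have hSW : ({S, T'} : Set (Module.End ℂ (complexBetti (⨁ (fun _ : Fin (n + 1) => A)).X 1))) ⊆ Submodule.span ℂ
        (Set.range fun st : (Fin (n + 1) × Fin 2) × (Fin (n + 1) × Fin 2) ↦ x st.1 * y st.2) :=
      hST'.trans (Submodule.span_le.2 (by rintro _ ⟨kl, rfl⟩; exact hW_pair kl.1 kl.2))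
    have hPT : ∀ q : ℂ[X], aeval T q ∈ Algebra.adjoin ℂ (insert T (Set.range
        fun st : (Fin (n + 1) × Fin 2) × (Fin (n + 1) × Fin 2) ↦ x st.1 * y st.2)) :=
      fun q ↦ Algebra.adjoin_mono (Set.singleton_subset_iff.2 (Set.mem_insert _ _))
        (Polynomial.aeval_mem_adjoin_singleton ℂ T)
    refine Set.insert_subset_iff.2 ⟨Algebra.subset_adjoin (Set.mem_insert _ _), Set.insert_subset_iff.2
      ⟨?_, Set.insert_subset_iff.2 ⟨?_, ?_⟩⟩⟩
    · rw [hSa_eq, hRa'def]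
      exact Subalgebra.mul_mem _ (hWR (hSW (Set.mem_insert _ _))) (hPT _)
    · rw [hSb_eq, hRb'def]
      exact Subalgebra.mul_mem _ (hWR (hSW (Set.mem_insert_of_mem _ (Set.mem_singleton _)))) (hPT _)
    · rintro _ ⟨ab, rfl⟩
      exact hWR (hW_unit ab.1 ab.2)
  -- THE EXPONENTS: `2 · dim(pV ∩ ker(T - z)) = dim ker(ψ^* - z)` at every place `z`
  have hTp : T * p = p * T := by
    change T * (U 0 0 * p') = U 0 0 * p' * T
    rw [← mul_assoc, hTU, mul_assoc, hTp', ← mul_assoc]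
  have hcorner : ∀ z ∈ s, 2 * Module.finrank ℂ ↥(LinearMap.range p ⊓ T.eigenspace z) =
      Module.finrank ℂ ↥((pullbackOne A ψ).eigenspace z) := by
    intro z hz
    have hPzU : aeval T (Lagrange.basis s id z) * U 0 0 = U 0 0 * aeval T (Lagrange.basis s id z) :=
      aeval_comm_of_comm T (U 0 0) (hTU 0 0) _
    have hPzp' : aeval T (Lagrange.basis s id z) * p' = p' * aeval T (Lagrange.basis s id z) :=
      aeval_comm_of_comm T p' hTp' _
    have hPzT' : aeval T (Lagrange.basis s id z) * T' = T' * aeval T (Lagrange.basis s id z) :=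
      aeval_comm_of_comm T T' hTT' _
    -- the corner and the slot as ranges of `(P_z e_{00}) p'` and `P_z e_{00}`
    have h1 : LinearMap.range p ⊓ T.eigenspace z = LinearMap.range (aeval T (Lagrange.basis s id z) * U 0 0 * p') := by
      rw [mul_assoc]
      exact (range_aeval_lagrange_basis_mul_eq_of_comm hsne hTnodal hTp hz).symm
    have h2 : LinearMap.range (aeval T (Lagrange.basis s id z) * U 0 0) = LinearMap.range (U 0 0) ⊓ T.eigenspace z :=
      range_aeval_lagrange_basis_mul_eq_of_comm hsne hTnodal (hTU 0 0) hz
    -- `2 dim((P_z e_{00}) p' V) = dim(P_z e_{00} V)`: `T'` exchanges the corners `p'V`, `q'V`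
    have hep : aeval T (Lagrange.basis s id z) * U 0 0 * p' = p' * (aeval T (Lagrange.basis s id z) * U 0 0) := by
      rw [mul_assoc, hUp', ← mul_assoc, hPzp', mul_assoc]
    have het : aeval T (Lagrange.basis s id z) * U 0 0 * T' = T' * (aeval T (Lagrange.basis s id z) * U 0 0) := by
      rw [mul_assoc, hUT', ← mul_assoc, hPzT', mul_assoc]
    rw [h1, two_mul_finrank_range_mul_eq_finrank_range hpq hqp hpq0 hT2 htpt hep het, h2]
    exact finrank_range_π_comp_ι_inf_eigenspace_biproductMap_eq ψ 0 z

  -- THE ADJOINT STRUCTURE: `x_{(i,0)}† = T' y_{(i,1)}`, `x_{(i,1)}† = -T' y_{(i,0)}`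
  have hqT : q' * T' = T' * p' := by rw [← htpt, mul_assoc (T' * p'), hT2, mul_one]
  have hq'apply : ∀ u, q' u = T' (p' (T' u)) := fun u ↦ by rw [← htpt]; rfl
  have hqT' : ∀ u, q' (T' u) = T' (p' u) := fun u ↦ by
    rw [← Module.End.mul_apply q' T', hqT, Module.End.mul_apply]
  have hadj0 : ∀ i (v w : complexBetti (⨁ (fun _ : Fin (n + 1) => A)).X 1),
      polarizationPairingOne (⨁ (fun _ : Fin (n + 1) => A)).X D ((⨁ (fun _ : Fin (n + 1) => A)).dim - 1) ((U i 0 * p') v) w =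
        polarizationPairingOne (⨁ (fun _ : Fin (n + 1) => A)).X D ((⨁ (fun _ : Fin (n + 1) => A)).dim - 1) v (T' (p' (T' (U 0 i w)))) := by
    intro i v w
    simp only [Module.End.mul_apply]
    rw [hUadj, hp'adj, hq'apply]
  have hadj1 : ∀ i (v w : complexBetti (⨁ (fun _ : Fin (n + 1) => A)).X 1),
      polarizationPairingOne (⨁ (fun _ : Fin (n + 1) => A)).X D ((⨁ (fun _ : Fin (n + 1) => A)).dim - 1) ((U i 0 * (T' * p')) v) w =
        -polarizationPairingOne (⨁ (fun _ : Fin (n + 1) => A)).X D ((⨁ (fun _ : Fin (n + 1) => A)).dim - 1) v (T' (p' (U 0 i w))) := by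
    intro i v w
    simp only [Module.End.mul_apply]
    rw [hUadj, hT'_skew, hp'adj, hqT']
  let σ : Fin (n + 1) × Fin 2 → Fin (n + 1) × Fin 2 := fun k ↦ (k.1, if k.2 = 0 then 1 else 0)
  let ε : Fin (n + 1) × Fin 2 → ℂ := fun k ↦ if k.2 = 0 then 1 else -1
  have hσ : Function.Involutive σ := by
    rintro ⟨i, c⟩
    fin_cases c <;> simp [σ]
  have hε : ∀ k, ε (σ k) = -ε k := by
    rintro ⟨i, c⟩
    fin_cases c <;> simp [σ, ε]
  have hadj : ∀ k (v w : complexBetti (⨁ (fun _ : Fin (n + 1) => A)).X 1),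
      polarizationPairingOne (⨁ (fun _ : Fin (n + 1) => A)).X D ((⨁ (fun _ : Fin (n + 1) => A)).dim - 1) (x k v) w =
        ε k • polarizationPairingOne (⨁ (fun _ : Fin (n + 1) => A)).X D ((⨁ (fun _ : Fin (n + 1) => A)).dim - 1) v (T' (y (σ k) w)) := by
    rintro ⟨i, c⟩ v w
    fin_cases c
    · simpa [x, y, x', y', σ, ε] using hadj0 i v w
    · simpa [x, y, x', y', σ, ε] using hadj1 i v w
  have hmem_s' : ∀ z : ℂ, (Q.map (Int.castRingHom ℂ)).IsRoot z → z ∈ s := fun z hz ↦ by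
    rw [hsdef]
    exact Multiset.mem_toFinset.2 ((Polynomial.mem_roots (hQm.map _).ne_zero).2 hz)
  exact ⟨T', p, x, y, σ, ε, hyx, hsumxy, ht'symm, htnd, hσ, hε, hadj, hTx, hTy, hTT', hxmem, hymem, hT'_mem, hgens,
    hTnodal, fun z hz ↦ hcorner z (hmem_s' z hz)⟩


section Split

variable {X : AbelianVariety ℂ} {ι : Type*} [Fintype ι] [DecidableEq ι]
  {x y : ι → Module.End ℂ (complexBetti X.X 1)} {p T : Module.End ℂ (complexBetti X.X 1)} {s : Finset ℂ}

/-- The block system of a Morita datum `(x, y, p)` split along the Lagrange projectors `P_z = ℓ_z(T)` of a commuting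
operator `T` with simple spectrum `s`: `(P_z xᵢ, P_z yᵢ, P_z p)_{z ∈ s}` is a system of matrix blocks with central
idempotents `Σᵢ (P_z xᵢ)(P_z yᵢ) = P_z`, whose units span a space containing `T` and every `x_a y_b`.
[cite: McconnellRobson2001, 3.5.5–3.5.7] [cite: HornJohnson2013, §1.1 and Thm. 1.3.7 ff.] -/
private theorem matrixBlocks_of_moritaData_of_centre' (hyx : ∀ i j, y i * x j = if i = j then p else 0)
    (hsum : ∑ i, x i * y i = 1) (hTx : ∀ i, T * x i = x i * T) (hTy : ∀ i, T * y i = y i * T) (hs : s.Nonempty)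
    (hTs : aeval T (Lagrange.nodal s id) = 0) {Pz : s → Module.End ℂ (complexBetti X.X 1)}
    (hPz : ∀ z, Pz z = aeval T (Lagrange.basis s id (z : ℂ))) :
    (∀ (z : s) i j, Pz z * y i * (Pz z * x j) = if i = j then Pz z * p else 0) ∧
    (∀ z z' : s, z ≠ z' → ∀ i j, Pz z * y i * (Pz z' * x j) = 0) ∧
    (∑ z : s, ∑ i, Pz z * x i * (Pz z * y i) = 1) ∧
    (∀ z : s, ∑ i, Pz z * x i * (Pz z * y i) = Pz z) ∧
    (insert T (Set.range fun ab : ι × ι ↦ x ab.1 * y ab.2) ⊆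
      (Submodule.span ℂ (Set.range fun w : s × ι × ι ↦ Pz w.1 * x w.2.1 * (Pz w.1 * y w.2.2)) :
        Set (Module.End ℂ (complexBetti X.X 1)))) := by
  classical
  obtain ⟨hPsum, hPorth, hPidem, hTP⟩ := aeval_lagrange_basis_spectral T s hs hTs
  have hPsum' : ∑ z : s, Pz z = 1 := by
    rw [← hPsum, ← Finset.sum_coe_sort s fun z ↦ aeval T (Lagrange.basis s id z)]
    exact Finset.sum_congr rfl fun z _ ↦ hPz z
  have hPidem' : ∀ z : s, Pz z * Pz z = Pz z := fun z ↦ by rw [hPz]; exact hPidem _ z.2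
  have hPorth' : ∀ z z' : s, z ≠ z' → Pz z * Pz z' = 0 := fun z z' hzz' ↦ by
    rw [hPz, hPz]; exact hPorth _ z.2 _ z'.2 fun e ↦ hzz' (Subtype.ext e)
  have hPx : ∀ (z : s) i, Pz z * x i = x i * Pz z := fun z i ↦ by
    rw [hPz]; exact aeval_comm_of_comm T (x i) (hTx i) _
  have hPy : ∀ (z : s) i, Pz z * y i = y i * Pz z := fun z i ↦ by
    rw [hPz]; exact aeval_comm_of_comm T (y i) (hTy i) _
  have hunit : ∀ (z : s) a b, Pz z * x a * (Pz z * y b) = Pz z * (x a * y b) := by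
    intro z a b
    rw [mul_assoc, ← mul_assoc (x a), ← hPx, mul_assoc, ← mul_assoc (Pz z), hPidem']
  have hQ : ∀ z : s, ∑ i, Pz z * x i * (Pz z * y i) = Pz z := fun z ↦ by
    simp_rw [hunit, ← Finset.mul_sum, hsum, mul_one]
  refine ⟨fun z i j ↦ ?_, fun z z' hzz' i j ↦ ?_, ?_, hQ, ?_⟩
  · rw [mul_assoc, ← mul_assoc (y i), ← hPy, mul_assoc, ← mul_assoc (Pz z), hPidem', hyx]
    split_ifs
    · rfl
    · rw [mul_zero]
  · rw [mul_assoc, ← mul_assoc (y i), ← hPy, mul_assoc, ← mul_assoc (Pz z), hPorth' z z' hzz', zero_mul]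
  · simp_rw [hQ]
    exact hPsum'
  · have hUmem : ∀ a b, x a * y b ∈ Submodule.span ℂ (Set.range fun w : s × ι × ι ↦ Pz w.1 * x w.2.1 * (Pz w.1 * y w.2.2)) := by
      intro a b
      have e1 : x a * y b = ∑ z : s, Pz z * x a * (Pz z * y b) := by
        simp_rw [hunit]
        rw [← Finset.sum_mul, hPsum', one_mul]
      rw [e1]
      exact Submodule.sum_mem _ fun z _ ↦ Submodule.subset_span ⟨(z, a, b), rfl⟩
    refine Set.insert_subset_iff.2 ⟨?_, ?_⟩
    · have e2 : T = ∑ z : s, ∑ i, (z : ℂ) • (Pz z * x i * (Pz z * y i)) := by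
        simp_rw [hunit, ← smul_mul_assoc, ← Finset.mul_sum, hsum, mul_one]
        rw [← mul_one T, ← hPsum', Finset.mul_sum]
        exact Finset.sum_congr rfl fun z _ ↦ by rw [hPz]; exact hTP _ z.2
      rw [e2]
      exact Submodule.sum_mem _ fun z _ ↦ Submodule.sum_mem _ fun i _ ↦
        Submodule.smul_mem _ _ (Submodule.subset_span ⟨(z, i, i), rfl⟩)
    · rintro _ ⟨ab, rfl⟩
      exact hUmem ab.1 ab.2

omit [Fintype ι] in
/-- The corners of the split system: `(P_z p) V = pV ∩ ker(T - z)`. [cite: McconnellRobson2001, 3.5.5–3.5.7] -/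
private theorem range_proj_mul_corner_eq' (hyx : ∀ i j, y i * x j = if i = j then p else 0)
    (hTx : ∀ i, T * x i = x i * T) (hTy : ∀ i, T * y i = y i * T) (hs : s.Nonempty)
    (hTs : aeval T (Lagrange.nodal s id) = 0) (i : ι) (z : s) :
    LinearMap.range (aeval T (Lagrange.basis s id (z : ℂ)) * p) = LinearMap.range p ⊓ T.eigenspace (z : ℂ) := by
  classical
  have hp : p = y i * x i := by rw [hyx, if_pos rfl]
  have hTp : T * p = p * T := by rw [hp, ← mul_assoc, hTy, mul_assoc, hTx, mul_assoc]
  have hPp : aeval T (Lagrange.basis s id (z : ℂ)) * p = p * aeval T (Lagrange.basis s id (z : ℂ)) :=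
    aeval_comm_of_comm T p hTp _
  rw [← range_aeval_lagrange_basis_eq_eigenspace hs hTs z.2]
  refine le_antisymm ?_ ?_
  · rintro _ ⟨v, rfl⟩
    refine ⟨⟨aeval T (Lagrange.basis s id (z : ℂ)) v, ?_⟩, ⟨p v, rfl⟩⟩
    rw [← Module.End.mul_apply, ← hPp]
  · rintro v ⟨⟨v', hv'⟩, ⟨v'', hv''⟩⟩
    obtain ⟨-, -, hPidem, -⟩ := aeval_lagrange_basis_spectral T s hs hTs
    refine ⟨v', ?_⟩
    rw [Module.End.mul_apply, hv', ← hv'', ← Module.End.mul_apply, hPidem _ z.2]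

end Split

/-- **MOONEN–ZARHIN's CRITERION (2), TYPE 3 ON POWERS, THE EXCEPTIONAL ALTERNATIVE — ODD EXPONENT ⟹ `W_F(A^{n+1}) ⊗ ℂ ⊓
𝒟ᵐ ⊗ ℂ = ⊥`.**  Let `A` be a complex abelian variety of positive dimension with `h ∈ B¹(A) ⊗ ℂ`, `h^{dim A} ≠ 0`, `Q_h`
non-degenerate; `ψ ∈ End(A)` ROSATI-SYMMETRIC with `Q(ψ) = 0`, `Q ∈ ℤ[T]` monic irreducible over `ℚ` (the totally real
centre `E = ℚ(ψ)`, of any degree); `α, β ∈ End(A)` ROSATI-SKEW, anticommuting, commuting with `ψ^*`, with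
`α^{*2} = a(ψ^*)`, `β^{*2} = b(ψ^*)`, `a, b` non-vanishing at the complex roots of `Q` (`D = E⟨α, β⟩` a definite
quaternion algebra so presented); `X = A^{n+1}` with the product polarization; and — «`End⁰(X) = M_m(D)`» — EVERY
pull-back `χ^*`, `χ ∈ End(X)`, in the complex algebra generated by `(⊕ψ)^*, (⊕α)^*, (⊕β)^*` and the matrix units
`(πₐ ≫ ι_b)^*`; `φ ∈ End(X)` with `P(φ) = 0`, `P ∈ ℤ[T]` monic irreducible of degree `e`, `e · 2m = 2(n+1) dim A`.  IF at
some complex root `ρ` of `P` and some complex root `z` of `Q`, `2 · dim(V_ρ ∩ ker((⊕ψ)^* - z))` is an ODD multiple of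
`dim ker(ψ^* - z)` — the exponent `l_z(ρ)` of the print's factor `G_div^{(z)} ≅ O_{2k}` is odd — THEN
`W_F ⊗ ℂ ⊓ 𝒟ᵐ ⊗ ℂ = ⊥`: all non-zero Weil classes of `F = ℚ(φ)` are exceptional.  Proof: the datum of
`exists_moritaData_cornerForm_adjoint_biproduct_of_definiteQuaternionOver_diagonal` fed to the seat's
`weilClassesField_inf_divisorClassesSpan_eq_bot_of_moritaData_of_cornerForm_of_symmetric_of_odd` (the reflection
`1 - 2Π_π ∈ S(X)(D_X)(ℂ)` of determinant `-1` on `V_ρ`).  The print's row «`Y` is of Type 3, `m ≥ 2` and the integer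
`2m · [E:ℚ]/[F:ℚ]` is odd ⟹ all non-zero classes in `W_F` are exceptional», with the parity read PLACE BY PLACE
(`Σ_z l_z(ρ) = 2m[E:ℚ]/[F:ℚ]`; see the honest column of `WeilClassesFieldOrthogonalCornersParity`), on the carrier.
[cite: MoonenZarhin1998WeilClasses, §1 Criterion (2), case «Type 3, m ≥ 2» and its proof (chunk p0003 L46–L60, L92–L111; p0004 L1–L27)]
[cite: Milne1999LefschetzClasses, §1 pp. 642–644, Thm. 3.2, Cor. 4.5] [cite: McconnellRobson2001, 3.5.5–3.5.7] -/
theorem weilClassesField_biproduct_inf_divisorClassesSpan_eq_bot_of_forall_mem_adjoin_definiteQuaternionOver_diagonal_of_odd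
    (hA : 0 < A.dim) (hh : h ∈ hodgeClassSpan A.dim A.X 1) (htop : lefschetzPow h (A.dim - 1) 2 h ≠ 0)
    (hnd : ∀ x : complexBetti A.X 1, (∀ y, polarizationPairingOne A.X h (A.dim - 1) x y = 0) → x = 0)
    (hψsym : ∀ v w : complexBetti A.X 1, polarizationPairingOne A.X h (A.dim - 1) (pullbackOne A ψ v) w =
      polarizationPairingOne A.X h (A.dim - 1) v (pullbackOne A ψ w))
    (hQm : Q.Monic) (hQirr : Irreducible (Q.map (Int.castRingHom ℚ)))
    (hψQ : Polynomial.eval₂ (Int.castRingHom (CategoryTheory.End A)) (ψ : CategoryTheory.End A) Q = 0)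
    (hα2 : pullbackOne A α * pullbackOne A α = aeval (pullbackOne A ψ) qa)
    (hqa : ∀ z : ℂ, (Q.map (Int.castRingHom ℂ)).IsRoot z → qa.eval z ≠ 0)
    (hβ2 : pullbackOne A β * pullbackOne A β = aeval (pullbackOne A ψ) qb)
    (hqb : ∀ z : ℂ, (Q.map (Int.castRingHom ℂ)).IsRoot z → qb.eval z ≠ 0)
    (hanti : pullbackOne A α * pullbackOne A β = -(pullbackOne A β * pullbackOne A α))
    (hαskew : ∀ v w : complexBetti A.X 1, polarizationPairingOne A.X h (A.dim - 1) (pullbackOne A α v) w =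
      -polarizationPairingOne A.X h (A.dim - 1) v (pullbackOne A α w))
    (hβskew : ∀ v w : complexBetti A.X 1, polarizationPairingOne A.X h (A.dim - 1) (pullbackOne A β v) w =
      -polarizationPairingOne A.X h (A.dim - 1) v (pullbackOne A β w))
    (hψα : pullbackOne A ψ * pullbackOne A α = pullbackOne A α * pullbackOne A ψ)
    (hψβ : pullbackOne A ψ * pullbackOne A β = pullbackOne A β * pullbackOne A ψ)
    (hPm : P.Monic) (hPe : P.natDegree = e) (hPirr : Irreducible (P.map (Int.castRingHom ℚ)))
    (hφ : Polynomial.eval₂ (Int.castRingHom (CategoryTheory.End (⨁ (fun _ : Fin (n + 1) => A))))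
      (φ : CategoryTheory.End (⨁ (fun _ : Fin (n + 1) => A))) P = 0)
    (her : e * (2 * m) = 2 * ((n + 1) * A.dim))
    (hEnd : ∀ χ : (⨁ (fun _ : Fin (n + 1) => A)) ⟶ (⨁ (fun _ : Fin (n + 1) => A)), pullbackOne (⨁ (fun _ : Fin (n + 1) => A)) χ ∈ Algebra.adjoin ℂ
      (insert (pullbackOne (⨁ (fun _ : Fin (n + 1) => A)) (biproduct.map fun _ : Fin (n + 1) => ψ))
        (insert (pullbackOne (⨁ (fun _ : Fin (n + 1) => A)) (biproduct.map fun _ : Fin (n + 1) => α))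
          (insert (pullbackOne (⨁ (fun _ : Fin (n + 1) => A)) (biproduct.map fun _ : Fin (n + 1) => β))
            (Set.range fun ab : Fin (n + 1) × Fin (n + 1) ↦ pullbackOne (⨁ (fun _ : Fin (n + 1) => A))
              (biproduct.π (fun _ : Fin (n + 1) => A) ab.1 ≫ biproduct.ι (fun _ : Fin (n + 1) => A) ab.2))))))
    (hodd : ∃ ρ : ℂ, Polynomial.eval₂ (Int.castRingHom ℂ) ρ P = 0 ∧ ∃ z : ℂ, (Q.map (Int.castRingHom ℂ)).IsRoot z ∧
      ∃ j : ℕ, 2 * Module.finrank ℂ ↥((pullbackOne (⨁ (fun _ : Fin (n + 1) => A)) φ).eigenspace ρ ⊓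
          (pullbackOne (⨁ (fun _ : Fin (n + 1) => A)) (biproduct.map fun _ : Fin (n + 1) => ψ)).eigenspace z) =
        (2 * j + 1) * Module.finrank ℂ ↥((pullbackOne A ψ).eigenspace z)) :
    weilClassesField (⨁ (fun _ : Fin (n + 1) => A)) φ P (2 * m) ⊓
      divisorClassesSpan (⨁ (fun _ : Fin (n + 1) => A)).X (⨁ (fun _ : Fin (n + 1) => A)).dim m = ⊥ := by
  classical
  obtain ⟨hhX, -, hndX⟩ := sumPolarizationClass_hypotheses (fun _ : Fin (n + 1) => A) (fun _ => h)
      (fun _ => hA) (fun _ => hh) (fun _ => htop) (fun _ => hnd)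
  have herX : e * (2 * m) = 2 * (⨁ (fun _ : Fin (n + 1) => A)).dim := by rw [dim_biproduct_const_succ A n, her]
  have hm : m ≠ 0 := by
    rintro rfl
    have h0 : (n + 1) * A.dim = 0 := by omega
    rcases Nat.mul_eq_zero.1 h0 with h1 | h1 <;> omega
  obtain ⟨t, p, x, y, σ, ε, hyx, hsum, htsymm, htnd, hσ, hε, hadj, hTx, hTy, hTt, -, -, -, hgens, hTnodal, hcorner⟩ :=
    exists_moritaData_cornerForm_adjoint_biproduct_of_definiteQuaternionOver_diagonal (n := n) hA hh htop hnd hψsym hQm hQirr hψQ hα2 hqa hβ2 hqb hanti hαskew hβskew hψα hψβ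
  obtain ⟨-, hsne⟩ := nodal_roots_toFinset hQm hQirr
  have hT_symm := (pullbackOne_biproductMap_mem_symmetricPullbackSpan (fun _ : Fin (n + 1) => A) (fun _ => h)
    (fun _ => hA) (fun _ => ψ) (fun _ => hψsym)).2
  obtain ⟨ρ, hρ, z, hz, j, hj⟩ := hodd
  have hzs : z ∈ (Q.map (Int.castRingHom ℂ)).roots.toFinset :=
    Multiset.mem_toFinset.2 ((Polynomial.mem_roots (hQm.map _).ne_zero).2 hz)
  have hz' : Polynomial.eval₂ (Int.castRingHom ℂ) z Q = 0 := by
    rwa [Polynomial.IsRoot.def, Polynomial.eval_map] at hz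
  have hd : 0 < Module.finrank ℂ ↥((pullbackOne A ψ).eigenspace z) := by
    have h1 := finrank_eigenspace_mul_natDegree_eq hQm hQirr hψQ hz'
    change Module.finrank ℂ ↥((pullbackOne A ψ).eigenspace z) * Q.natDegree = 2 * A.dim at h1
    refine Nat.pos_of_ne_zero fun h0 ↦ ?_
    rw [h0, zero_mul] at h1
    omega
  have hc := hcorner z hz
  refine weilClassesField_inf_divisorClassesSpan_eq_bot_of_moritaData_of_cornerForm_of_symmetric_of_odd hPm hPe hPirr hφ
    herX hm hhX hndX hyx hsum htsymm htnd hadj hσ hε hT_symm hTx hTy hTt hsne hTnodal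
    (fun χ ↦ Algebra.adjoin_le hgens (hEnd χ)) ⟨ρ, hρ, z, hzs, fun h0 ↦ ?_, j, ?_⟩
  · rw [h0, finrank_bot, mul_zero] at hc
    omega
  · have h2 : 2 * Module.finrank ℂ ↥((pullbackOne (⨁ (fun _ : Fin (n + 1) => A)) φ).eigenspace ρ ⊓
          (pullbackOne (⨁ (fun _ : Fin (n + 1) => A)) (biproduct.map fun _ : Fin (n + 1) => ψ)).eigenspace z) =
        2 * ((2 * j + 1) * Module.finrank ℂ ↥(LinearMap.range p ⊓ (pullbackOne (⨁ (fun _ : Fin (n + 1) => A)) (biproduct.map fun _ : Fin (n + 1) => ψ)).eigenspace z)) := by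
      rw [hj, ← hc]
      ring
    omega

/-- **THE EXPONENTS EXIST: `2 · dim(V_ρ ∩ ker((⊕ψ)^* - z)) = l_z(ρ) · dim ker(ψ^* - z)`** — for `φ^*` in the complex algebra
generated by `(⊕ψ)^*, (⊕α)^*, (⊕β)^*, (πₐ ≫ ι_b)^*` (hypotheses of the previous theorems), every eigenvalue `ρ` of `φ^*`
and every complex root `z` of `Q`, there is a natural number `l = l_z(ρ)` with `2 · dim(V_ρ ∩ ker((⊕ψ)^* - z)) =
l · dim ker(ψ^* - z)` — the Morita exponent of `ρ` at the place `z` (`dim(V_ρ ∩ V^{(z)}) = l · dim(pV ∩ V^{(z)})` by the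
seat's `exists_forall_det_restrict_eigenspace_eq_prod_pow` on the blocks split along the places, and `2 dim(pV ∩ V^{(z)}) =
dim ker(ψ^* - z)`), so that the
hypotheses «`dim ker(ψ^* - z) ∣ dim(V_ρ ∩ ker((⊕ψ)^* - z))`» (even) of
`WeilClassesFieldDefiniteQuaternionMatricesDecomposable` and «`2 dim(…)` an odd multiple of `dim ker(ψ^* - z)`» (odd) of
this file are each other's negation.
[cite: MoonenZarhin1998WeilClasses, §1 «Δ ⊗ ℂ = ∏_τ Δ_ℂ^{(τ)}», Table 2 and proof of Criterion (2), type 3 (chunk p0002 L104–L118, p0003 L92–L111)]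
[cite: McconnellRobson2001, 3.5.5–3.5.7] -/
theorem exists_two_mul_finrank_eq_mul_of_mem_adjoin_definiteQuaternionOver_diagonal
    (hA : 0 < A.dim) (hh : h ∈ hodgeClassSpan A.dim A.X 1) (htop : lefschetzPow h (A.dim - 1) 2 h ≠ 0)
    (hnd : ∀ x : complexBetti A.X 1, (∀ y, polarizationPairingOne A.X h (A.dim - 1) x y = 0) → x = 0)
    (hψsym : ∀ v w : complexBetti A.X 1, polarizationPairingOne A.X h (A.dim - 1) (pullbackOne A ψ v) w =
      polarizationPairingOne A.X h (A.dim - 1) v (pullbackOne A ψ w))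
    (hQm : Q.Monic) (hQirr : Irreducible (Q.map (Int.castRingHom ℚ)))
    (hψQ : Polynomial.eval₂ (Int.castRingHom (CategoryTheory.End A)) (ψ : CategoryTheory.End A) Q = 0)
    (hα2 : pullbackOne A α * pullbackOne A α = aeval (pullbackOne A ψ) qa)
    (hqa : ∀ z : ℂ, (Q.map (Int.castRingHom ℂ)).IsRoot z → qa.eval z ≠ 0)
    (hβ2 : pullbackOne A β * pullbackOne A β = aeval (pullbackOne A ψ) qb)
    (hqb : ∀ z : ℂ, (Q.map (Int.castRingHom ℂ)).IsRoot z → qb.eval z ≠ 0)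
    (hanti : pullbackOne A α * pullbackOne A β = -(pullbackOne A β * pullbackOne A α))
    (hαskew : ∀ v w : complexBetti A.X 1, polarizationPairingOne A.X h (A.dim - 1) (pullbackOne A α v) w =
      -polarizationPairingOne A.X h (A.dim - 1) v (pullbackOne A α w))
    (hβskew : ∀ v w : complexBetti A.X 1, polarizationPairingOne A.X h (A.dim - 1) (pullbackOne A β v) w =
      -polarizationPairingOne A.X h (A.dim - 1) v (pullbackOne A β w))
    (hψα : pullbackOne A ψ * pullbackOne A α = pullbackOne A α * pullbackOne A ψ)
    (hψβ : pullbackOne A ψ * pullbackOne A β = pullbackOne A β * pullbackOne A ψ)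
    (hF : pullbackOne (⨁ (fun _ : Fin (n + 1) => A)) φ ∈ Algebra.adjoin ℂ
      (insert (pullbackOne (⨁ (fun _ : Fin (n + 1) => A)) (biproduct.map fun _ : Fin (n + 1) => ψ))
        (insert (pullbackOne (⨁ (fun _ : Fin (n + 1) => A)) (biproduct.map fun _ : Fin (n + 1) => α))
          (insert (pullbackOne (⨁ (fun _ : Fin (n + 1) => A)) (biproduct.map fun _ : Fin (n + 1) => β))
            (Set.range fun ab : Fin (n + 1) × Fin (n + 1) ↦ pullbackOne (⨁ (fun _ : Fin (n + 1) => A))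
              (biproduct.π (fun _ : Fin (n + 1) => A) ab.1 ≫ biproduct.ι (fun _ : Fin (n + 1) => A) ab.2))))))
    (ρ : ℂ) {z : ℂ} (hz : (Q.map (Int.castRingHom ℂ)).IsRoot z) :
    ∃ l : ℕ, 2 * Module.finrank ℂ ↥((pullbackOne (⨁ (fun _ : Fin (n + 1) => A)) φ).eigenspace ρ ⊓
          (pullbackOne (⨁ (fun _ : Fin (n + 1) => A)) (biproduct.map fun _ : Fin (n + 1) => ψ)).eigenspace z) =
      l * Module.finrank ℂ ↥((pullbackOne A ψ).eigenspace z) := by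
  classical
  obtain ⟨t, p, x, y, σ, ε, hyx, hsum, -, -, -, -, -, hTx, hTy, -, -, -, -, hgens, hTnodal, hcorner⟩ :=
    exists_moritaData_cornerForm_adjoint_biproduct_of_definiteQuaternionOver_diagonal (n := n) hA hh htop hnd hψsym hQm hQirr hψQ hα2 hqa hβ2 hqb hanti hαskew hβskew hψα hψβ
  obtain ⟨-, hsne⟩ := nodal_roots_toFinset hQm hQirr
  haveI : Module.Finite ℂ (complexBetti (⨁ (fun _ : Fin (n + 1) => A)).X 1) :=
    abelianVarietyCohomologyExteriorH1_holds.finite_one _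
  set T : Module.End ℂ (complexBetti (⨁ (fun _ : Fin (n + 1) => A)).X 1) := pullbackOne (⨁ (fun _ : Fin (n + 1) => A)) (biproduct.map fun _ : Fin (n + 1) => ψ) with hTdef
  set S : Finset ℂ := (Q.map (Int.castRingHom ℂ)).roots.toFinset with hSdef
  have hzs : z ∈ S := Multiset.mem_toFinset.2 ((Polynomial.mem_roots (hQm.map _).ne_zero).2 hz)
  obtain ⟨Pz, hPz⟩ : ∃ Pz : S → Module.End ℂ (complexBetti (⨁ (fun _ : Fin (n + 1) => A)).X 1), ∀ w, Pz w = aeval T (Lagrange.basis S id (w : ℂ)) := ⟨_, fun _ ↦ rfl⟩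
  obtain ⟨hxy', hcross, hsum', hQ, hgen⟩ := matrixBlocks_of_moritaData_of_centre' hyx hsum hTx hTy hsne hTnodal hPz
  obtain ⟨c, hcφ⟩ := exists_eq_sum_smul_of_mem_span_units_blocks (K := ℂ) (κ := ↥S) (ι := Fin (n + 1) × Fin 2)
    (x := fun w i ↦ Pz w * x i) (y := fun w i ↦ Pz w * y i)
    (adjoin_le_span_units_of_matrixBlocks hxy' hcross hsum' hgen (Algebra.adjoin_le hgens hF))
  obtain ⟨l, hl, -⟩ := exists_forall_det_restrict_eigenspace_eq_prod_pow (x := fun w i ↦ Pz w * x i)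
    (y := fun w i ↦ Pz w * y i) (p := fun w ↦ Pz w * p) hxy' hcross hsum' c hcφ ρ
  refine ⟨l ⟨z, hzs⟩, ?_⟩
  have h1 := hl ⟨z, hzs⟩
  rw [hQ, hPz, range_aeval_lagrange_basis_eq_eigenspace hsne hTnodal hzs,
    range_proj_mul_corner_eq' hyx hTx hTy hsne hTnodal ((0 : Fin (n + 1)), (0 : Fin 2)) ⟨z, hzs⟩] at h1
  rw [← hcorner z hz, ← h1]
  ring

/-- **THE DICHOTOMY ON POWERS, DECOMPOSABLE SIDE: `W_F ⊗ ℂ ≤ 𝒟ᵐ ⊗ ℂ` IFF EVERY PER-PLACE EXPONENT IS EVEN**, i.e. iff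
`dim ker(ψ^* - z) ∣ dim(V_ρ ∩ ker((⊕ψ)^* - z))` for all roots `ρ` of `P` and `z` of `Q` («⟸» is the seat's
`weilClassesField_biproduct_le_divisorClassesSpan_of_mem_adjoin_definiteQuaternionOver_diagonal_of_dvd`; «⟹» by the
exceptional alternative and `W_F ≠ 0`), under «every `χ^*` in `ℂ⟨(⊕ψ)^*, (⊕α)^*, (⊕β)^*, (πₐ ≫ ι_b)^*⟩`».  The print:
«either all classes in `W_F` are decomposable, or all non-zero classes in `W_F` are exceptional; this last possibility
occurs precisely in the following cases: … `Y` is of Type 3, `m ≥ 2` and the integer `2m · [E:ℚ] / [F:ℚ]` is odd».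
[cite: MoonenZarhin1998WeilClasses, §1 Criterion (2) and its proof, type 3 (chunk p0003 L46–L60, L92–L111; p0004 L1–L27)]
[cite: Milne1999LefschetzClasses, §1 pp. 642–644, Thm. 3.2, Cor. 4.5] -/
theorem weilClassesField_biproduct_le_divisorClassesSpan_iff_forall_dvd_of_forall_mem_adjoin_definiteQuaternionOver_diagonal
    (hA : 0 < A.dim) (hh : h ∈ hodgeClassSpan A.dim A.X 1) (htop : lefschetzPow h (A.dim - 1) 2 h ≠ 0)
    (hnd : ∀ x : complexBetti A.X 1, (∀ y, polarizationPairingOne A.X h (A.dim - 1) x y = 0) → x = 0)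
    (hψsym : ∀ v w : complexBetti A.X 1, polarizationPairingOne A.X h (A.dim - 1) (pullbackOne A ψ v) w =
      polarizationPairingOne A.X h (A.dim - 1) v (pullbackOne A ψ w))
    (hQm : Q.Monic) (hQirr : Irreducible (Q.map (Int.castRingHom ℚ)))
    (hψQ : Polynomial.eval₂ (Int.castRingHom (CategoryTheory.End A)) (ψ : CategoryTheory.End A) Q = 0)
    (hα2 : pullbackOne A α * pullbackOne A α = aeval (pullbackOne A ψ) qa)
    (hqa : ∀ z : ℂ, (Q.map (Int.castRingHom ℂ)).IsRoot z → qa.eval z ≠ 0)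
    (hβ2 : pullbackOne A β * pullbackOne A β = aeval (pullbackOne A ψ) qb)
    (hqb : ∀ z : ℂ, (Q.map (Int.castRingHom ℂ)).IsRoot z → qb.eval z ≠ 0)
    (hanti : pullbackOne A α * pullbackOne A β = -(pullbackOne A β * pullbackOne A α))
    (hαskew : ∀ v w : complexBetti A.X 1, polarizationPairingOne A.X h (A.dim - 1) (pullbackOne A α v) w =
      -polarizationPairingOne A.X h (A.dim - 1) v (pullbackOne A α w))
    (hβskew : ∀ v w : complexBetti A.X 1, polarizationPairingOne A.X h (A.dim - 1) (pullbackOne A β v) w =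
      -polarizationPairingOne A.X h (A.dim - 1) v (pullbackOne A β w))
    (hψα : pullbackOne A ψ * pullbackOne A α = pullbackOne A α * pullbackOne A ψ)
    (hψβ : pullbackOne A ψ * pullbackOne A β = pullbackOne A β * pullbackOne A ψ)
    (hPm : P.Monic) (hPe : P.natDegree = e) (hPirr : Irreducible (P.map (Int.castRingHom ℚ)))
    (hφ : Polynomial.eval₂ (Int.castRingHom (CategoryTheory.End (⨁ (fun _ : Fin (n + 1) => A))))
      (φ : CategoryTheory.End (⨁ (fun _ : Fin (n + 1) => A))) P = 0)
    (her : e * (2 * m) = 2 * ((n + 1) * A.dim))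
    (hEnd : ∀ χ : (⨁ (fun _ : Fin (n + 1) => A)) ⟶ (⨁ (fun _ : Fin (n + 1) => A)), pullbackOne (⨁ (fun _ : Fin (n + 1) => A)) χ ∈ Algebra.adjoin ℂ
      (insert (pullbackOne (⨁ (fun _ : Fin (n + 1) => A)) (biproduct.map fun _ : Fin (n + 1) => ψ))
        (insert (pullbackOne (⨁ (fun _ : Fin (n + 1) => A)) (biproduct.map fun _ : Fin (n + 1) => α))
          (insert (pullbackOne (⨁ (fun _ : Fin (n + 1) => A)) (biproduct.map fun _ : Fin (n + 1) => β))
            (Set.range fun ab : Fin (n + 1) × Fin (n + 1) ↦ pullbackOne (⨁ (fun _ : Fin (n + 1) => A))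
              (biproduct.π (fun _ : Fin (n + 1) => A) ab.1 ≫ biproduct.ι (fun _ : Fin (n + 1) => A) ab.2)))))) :
    weilClassesField (⨁ (fun _ : Fin (n + 1) => A)) φ P (2 * m) ≤
        divisorClassesSpan (⨁ (fun _ : Fin (n + 1) => A)).X (⨁ (fun _ : Fin (n + 1) => A)).dim m ↔
      ∀ ρ : ℂ, Polynomial.eval₂ (Int.castRingHom ℂ) ρ P = 0 → ∀ z : ℂ, (Q.map (Int.castRingHom ℂ)).IsRoot z →
        Module.finrank ℂ ↥((pullbackOne A ψ).eigenspace z) ∣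
          Module.finrank ℂ ↥((pullbackOne (⨁ (fun _ : Fin (n + 1) => A)) φ).eigenspace ρ ⊓
          (pullbackOne (⨁ (fun _ : Fin (n + 1) => A)) (biproduct.map fun _ : Fin (n + 1) => ψ)).eigenspace z) := by
  refine ⟨fun hle ρ hρ z hz ↦ ?_, fun hdvd ↦
    weilClassesField_biproduct_le_divisorClassesSpan_of_mem_adjoin_definiteQuaternionOver_diagonal_of_dvd hA hh htop hnd
      hψsym hQm hQirr hψQ hα2 hqa hβ2 hqb hanti hαskew hβskew hψα hψβ hPm hPe hPirr hφ her (hEnd φ) hdvd⟩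
  by_contra hndvd
  have herX : e * (2 * m) = 2 * (⨁ (fun _ : Fin (n + 1) => A)).dim := by rw [dim_biproduct_const_succ A n, her]
  obtain ⟨l, hl⟩ := exists_two_mul_finrank_eq_mul_of_mem_adjoin_definiteQuaternionOver_diagonal (n := n) hA hh htop hnd hψsym hQm hQirr hψQ hα2 hqa hβ2 hqb hanti hαskew hβskew hψα hψβ
    (hEnd φ) ρ hz
  obtain ⟨j, hj | hj⟩ := Nat.even_or_odd' l
  · refine hndvd ⟨j, Nat.eq_of_mul_eq_mul_left two_pos ?_⟩
    rw [hl, hj]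
    ring
  · have hbot :=
      weilClassesField_biproduct_inf_divisorClassesSpan_eq_bot_of_forall_mem_adjoin_definiteQuaternionOver_diagonal_of_odd
        hA hh htop hnd hψsym hQm hQirr hψQ hα2 hqa hβ2 hqb hanti hαskew hβskew hψα hψβ hPm hPe hPirr hφ her hEnd
        ⟨ρ, hρ, z, hz, j, by rw [hl, hj]⟩
    obtain ⟨γ, hγW, -, hγ0⟩ := exists_isRationalClass_ne_zero_mem_weilClassesField hPm hPe hPirr hφ herX
    have h0 : γ ∈ weilClassesField (⨁ (fun _ : Fin (n + 1) => A)) φ P (2 * m) ⊓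
        divisorClassesSpan (⨁ (fun _ : Fin (n + 1) => A)).X (⨁ (fun _ : Fin (n + 1) => A)).dim m := ⟨hγW, hle hγW⟩
    rw [hbot, Submodule.mem_bot] at h0
    exact hγ0 h0

/-- **THE DICHOTOMY ON POWERS, EXCEPTIONAL SIDE: `W_F ⊗ ℂ ⊓ 𝒟ᵐ ⊗ ℂ = ⊥` IFF SOME PER-PLACE EXPONENT IS ODD**, i.e. iff
`2 · dim(V_ρ ∩ ker((⊕ψ)^* - z))` is an odd multiple of `dim ker(ψ^* - z)` at some root `ρ` of `P` and some root `z` of `Q`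
(same hypotheses). [cite: MoonenZarhin1998WeilClasses, §1 Criterion (2) («this last possibility occurs precisely in the following cases: … Y is of Type 3, m ≥ 2 and the integer 2m·[E:ℚ]/[F:ℚ] is odd») and its proof (chunk p0003 L46–L60, L92–L111; p0004 L1–L27)]
[cite: Milne1999LefschetzClasses, §1 pp. 642–644, Thm. 3.2, Cor. 4.5] -/
theorem weilClassesField_biproduct_inf_divisorClassesSpan_eq_bot_iff_exists_odd_of_forall_mem_adjoin_definiteQuaternionOver_diagonal
    (hA : 0 < A.dim) (hh : h ∈ hodgeClassSpan A.dim A.X 1) (htop : lefschetzPow h (A.dim - 1) 2 h ≠ 0)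
    (hnd : ∀ x : complexBetti A.X 1, (∀ y, polarizationPairingOne A.X h (A.dim - 1) x y = 0) → x = 0)
    (hψsym : ∀ v w : complexBetti A.X 1, polarizationPairingOne A.X h (A.dim - 1) (pullbackOne A ψ v) w =
      polarizationPairingOne A.X h (A.dim - 1) v (pullbackOne A ψ w))
    (hQm : Q.Monic) (hQirr : Irreducible (Q.map (Int.castRingHom ℚ)))
    (hψQ : Polynomial.eval₂ (Int.castRingHom (CategoryTheory.End A)) (ψ : CategoryTheory.End A) Q = 0)
    (hα2 : pullbackOne A α * pullbackOne A α = aeval (pullbackOne A ψ) qa)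
    (hqa : ∀ z : ℂ, (Q.map (Int.castRingHom ℂ)).IsRoot z → qa.eval z ≠ 0)
    (hβ2 : pullbackOne A β * pullbackOne A β = aeval (pullbackOne A ψ) qb)
    (hqb : ∀ z : ℂ, (Q.map (Int.castRingHom ℂ)).IsRoot z → qb.eval z ≠ 0)
    (hanti : pullbackOne A α * pullbackOne A β = -(pullbackOne A β * pullbackOne A α))
    (hαskew : ∀ v w : complexBetti A.X 1, polarizationPairingOne A.X h (A.dim - 1) (pullbackOne A α v) w =
      -polarizationPairingOne A.X h (A.dim - 1) v (pullbackOne A α w))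
    (hβskew : ∀ v w : complexBetti A.X 1, polarizationPairingOne A.X h (A.dim - 1) (pullbackOne A β v) w =
      -polarizationPairingOne A.X h (A.dim - 1) v (pullbackOne A β w))
    (hψα : pullbackOne A ψ * pullbackOne A α = pullbackOne A α * pullbackOne A ψ)
    (hψβ : pullbackOne A ψ * pullbackOne A β = pullbackOne A β * pullbackOne A ψ)
    (hPm : P.Monic) (hPe : P.natDegree = e) (hPirr : Irreducible (P.map (Int.castRingHom ℚ)))
    (hφ : Polynomial.eval₂ (Int.castRingHom (CategoryTheory.End (⨁ (fun _ : Fin (n + 1) => A))))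
      (φ : CategoryTheory.End (⨁ (fun _ : Fin (n + 1) => A))) P = 0)
    (her : e * (2 * m) = 2 * ((n + 1) * A.dim))
    (hEnd : ∀ χ : (⨁ (fun _ : Fin (n + 1) => A)) ⟶ (⨁ (fun _ : Fin (n + 1) => A)), pullbackOne (⨁ (fun _ : Fin (n + 1) => A)) χ ∈ Algebra.adjoin ℂ
      (insert (pullbackOne (⨁ (fun _ : Fin (n + 1) => A)) (biproduct.map fun _ : Fin (n + 1) => ψ))
        (insert (pullbackOne (⨁ (fun _ : Fin (n + 1) => A)) (biproduct.map fun _ : Fin (n + 1) => α))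
          (insert (pullbackOne (⨁ (fun _ : Fin (n + 1) => A)) (biproduct.map fun _ : Fin (n + 1) => β))
            (Set.range fun ab : Fin (n + 1) × Fin (n + 1) ↦ pullbackOne (⨁ (fun _ : Fin (n + 1) => A))
              (biproduct.π (fun _ : Fin (n + 1) => A) ab.1 ≫ biproduct.ι (fun _ : Fin (n + 1) => A) ab.2)))))) :
    weilClassesField (⨁ (fun _ : Fin (n + 1) => A)) φ P (2 * m) ⊓
        divisorClassesSpan (⨁ (fun _ : Fin (n + 1) => A)).X (⨁ (fun _ : Fin (n + 1) => A)).dim m = ⊥ ↔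
      ∃ ρ : ℂ, Polynomial.eval₂ (Int.castRingHom ℂ) ρ P = 0 ∧ ∃ z : ℂ, (Q.map (Int.castRingHom ℂ)).IsRoot z ∧
        ∃ j : ℕ, 2 * Module.finrank ℂ ↥((pullbackOne (⨁ (fun _ : Fin (n + 1) => A)) φ).eigenspace ρ ⊓
          (pullbackOne (⨁ (fun _ : Fin (n + 1) => A)) (biproduct.map fun _ : Fin (n + 1) => ψ)).eigenspace z) =
          (2 * j + 1) * Module.finrank ℂ ↥((pullbackOne A ψ).eigenspace z) := by
  refine ⟨fun hbot ↦ ?_, fun hodd ↦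
    weilClassesField_biproduct_inf_divisorClassesSpan_eq_bot_of_forall_mem_adjoin_definiteQuaternionOver_diagonal_of_odd hA
      hh htop hnd hψsym hQm hQirr hψQ hα2 hqa hβ2 hqb hanti hαskew hβskew hψα hψβ hPm hPe hPirr hφ her hEnd hodd⟩
  by_contra hne
  push Not at hne
  have herX : e * (2 * m) = 2 * (⨁ (fun _ : Fin (n + 1) => A)).dim := by rw [dim_biproduct_const_succ A n, her]
  have hle : weilClassesField (⨁ (fun _ : Fin (n + 1) => A)) φ P (2 * m) ≤
      divisorClassesSpan (⨁ (fun _ : Fin (n + 1) => A)).X (⨁ (fun _ : Fin (n + 1) => A)).dim m := by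
    refine (weilClassesField_biproduct_le_divisorClassesSpan_iff_forall_dvd_of_forall_mem_adjoin_definiteQuaternionOver_diagonal
      hA hh htop hnd hψsym hQm hQirr hψQ hα2 hqa hβ2 hqb hanti hαskew hβskew hψα hψβ hPm hPe hPirr hφ her hEnd).2
      fun ρ hρ z hz ↦ ?_
    obtain ⟨l, hl⟩ := exists_two_mul_finrank_eq_mul_of_mem_adjoin_definiteQuaternionOver_diagonal (n := n) hA hh htop hnd hψsym hQm hQirr hψQ hα2 hqa hβ2 hqb hanti hαskew hβskew hψα hψβ
      (hEnd φ) ρ hz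
    obtain ⟨j, hj | hj⟩ := Nat.even_or_odd' l
    · refine ⟨j, Nat.eq_of_mul_eq_mul_left two_pos ?_⟩
      rw [hl, hj]
      ring
    · exact absurd (by rw [hl, hj]) (hne ρ hρ z hz j)
  obtain ⟨γ, hγW, -, hγ0⟩ := exists_isRationalClass_ne_zero_mem_weilClassesField hPm hPe hPirr hφ herX
  have h0 : γ ∈ weilClassesField (⨁ (fun _ : Fin (n + 1) => A)) φ P (2 * m) ⊓
      divisorClassesSpan (⨁ (fun _ : Fin (n + 1) => A)).X (⨁ (fun _ : Fin (n + 1) => A)).dim m := ⟨hγW, hle hγW⟩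
  rw [hbot, Submodule.mem_bot] at h0
  exact hγ0 h0

end DefiniteQuaternionMatrices

/-! ### §2 Centre `ℚ` (`e₀ = 1`): `D = ℚ⟨α, β⟩` definite, `End⁰(X) = M_{n+1}(D)` — exceptional iff `dim A ∤ m`, i.e. iff
`[F:ℚ] ∤ n + 1`; the print's «`2m′/[F:ℚ]` odd» (`m′ = n + 1`) for `Y` of type 3 with centre `ℚ` -/

section DefiniteQuaternionOverRat

variable {A : AbelianVariety ℂ} {h : complexBetti A.X 2} {n : ℕ} {α β : A ⟶ A} {a b : ℂ}
  {φ : ⨁ (fun _ : Fin (n + 1) => A) ⟶ ⨁ (fun _ : Fin (n + 1) => A)} {P : Polynomial ℤ} {e m : ℕ}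

/-- **TYPE 3 OVER `ℚ` ON POWERS — `W_F(A^{n+1})` IS EXCEPTIONAL WHEN `dim A ∤ m`.**  Let `A` be a complex abelian variety
of positive dimension with `h ∈ B¹(A) ⊗ ℂ`, `h^{dim A} ≠ 0`, `Q_h` non-degenerate; `α, β ∈ End(A)` ROSATI-SKEW,
anticommuting, `α^{*2} = a`, `β^{*2} = b` non-zero scalars (`D = ℚ⟨α, β⟩` definite quaternion over `ℚ` so presented);
every pull-back `χ^*` of `X = A^{n+1}` in `ℂ⟨(⊕α)^*, (⊕β)^*, (πₐ ≫ ι_b)^*⟩` («`End⁰(X) = M_{n+1}(D)`»); `φ ∈ End(X)`,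
`P(φ) = 0`, `P` monic irreducible of degree `e`, `e · 2m = 2(n+1) dim A`.  If `dim A ∤ m` — the single exponent
`l(ρ) = 2m/dim A` is then odd; for `A` simple of type 3 with `End⁰(A) = D` this is the print's «`2m′/[F:ℚ]` odd»,
`m′ = n + 1`, as `2m/dim A = 2(n+1)/e` — then `W_F ⊗ ℂ ⊓ 𝒟ᵐ ⊗ ℂ = ⊥` for the product polarization (§1 with `ψ = 𝟙`,
`Q = T - 1`, one place).
[cite: MoonenZarhin1998WeilClasses, §1 Criterion (2), case «Type 3, m ≥ 2, 2m·[E:ℚ]/[F:ℚ] odd» with E = ℚ, and its proof (chunk p0003 L46–L60, L92–L111)]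
[cite: Milne1999LefschetzClasses, §1 p. 643, Thm. 3.2, Cor. 4.5] -/
theorem weilClassesField_biproduct_inf_divisorClassesSpan_eq_bot_of_forall_mem_adjoin_definiteQuaternion_diagonal_of_not_dvd
    (hA : 0 < A.dim) (hh : h ∈ hodgeClassSpan A.dim A.X 1) (htop : lefschetzPow h (A.dim - 1) 2 h ≠ 0)
    (hnd : ∀ x : complexBetti A.X 1, (∀ y, polarizationPairingOne A.X h (A.dim - 1) x y = 0) → x = 0)
    (ha : a ≠ 0) (hα2 : pullbackOne A α * pullbackOne A α = a • 1)
    (hb : b ≠ 0) (hβ2 : pullbackOne A β * pullbackOne A β = b • 1)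
    (hanti : pullbackOne A α * pullbackOne A β = -(pullbackOne A β * pullbackOne A α))
    (hαskew : ∀ v w : complexBetti A.X 1, polarizationPairingOne A.X h (A.dim - 1) (pullbackOne A α v) w =
      -polarizationPairingOne A.X h (A.dim - 1) v (pullbackOne A α w))
    (hβskew : ∀ v w : complexBetti A.X 1, polarizationPairingOne A.X h (A.dim - 1) (pullbackOne A β v) w =
      -polarizationPairingOne A.X h (A.dim - 1) v (pullbackOne A β w))
    (hPm : P.Monic) (hPe : P.natDegree = e) (hPirr : Irreducible (P.map (Int.castRingHom ℚ)))
    (hφ : Polynomial.eval₂ (Int.castRingHom (CategoryTheory.End (⨁ (fun _ : Fin (n + 1) => A))))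
      (φ : CategoryTheory.End (⨁ (fun _ : Fin (n + 1) => A))) P = 0)
    (her : e * (2 * m) = 2 * ((n + 1) * A.dim))
    (hEnd : ∀ χ : (⨁ (fun _ : Fin (n + 1) => A)) ⟶ (⨁ (fun _ : Fin (n + 1) => A)), pullbackOne (⨁ (fun _ : Fin (n + 1) => A)) χ ∈ Algebra.adjoin ℂ
      (insert (pullbackOne (⨁ (fun _ : Fin (n + 1) => A)) (biproduct.map fun _ : Fin (n + 1) => α))
        (insert (pullbackOne (⨁ (fun _ : Fin (n + 1) => A)) (biproduct.map fun _ : Fin (n + 1) => β))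
          (Set.range fun ab : Fin (n + 1) × Fin (n + 1) ↦ pullbackOne (⨁ (fun _ : Fin (n + 1) => A))
            (biproduct.π (fun _ : Fin (n + 1) => A) ab.1 ≫ biproduct.ι (fun _ : Fin (n + 1) => A) ab.2)))))
    (hndvd : ¬ A.dim ∣ m) :
    weilClassesField (⨁ (fun _ : Fin (n + 1) => A)) φ P (2 * m) ⊓
      divisorClassesSpan (⨁ (fun _ : Fin (n + 1) => A)).X (⨁ (fun _ : Fin (n + 1) => A)).dim m = ⊥ := by
  classical
  have herX : e * (2 * m) = 2 * (⨁ (fun _ : Fin (n + 1) => A)).dim := by rw [dim_biproduct_const_succ A n, her]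
  have h1 : pullbackOne A (𝟙 A) = 1 := pullbackOne_id_eq_one
  have hT1 : pullbackOne (⨁ (fun _ : Fin (n + 1) => A)) (biproduct.map fun _ : Fin (n + 1) => 𝟙 A) = 1 := by
    have e1 : (biproduct.map fun _ : Fin (n + 1) => 𝟙 A) = 𝟙 (⨁ (fun _ : Fin (n + 1) => A)) :=
      biproduct.hom_ext _ _ fun j ↦ by rw [biproduct.map_π, Category.comp_id, Category.id_comp]
    rw [e1, pullbackOne_id_eq_one]
  have hQm : (Polynomial.X - Polynomial.C (1 : ℤ)).Monic := Polynomial.monic_X_sub_C 1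
  have hQirr : Irreducible ((Polynomial.X - Polynomial.C (1 : ℤ)).map (Int.castRingHom ℚ)) := by
    rw [Polynomial.map_sub, Polynomial.map_X, Polynomial.map_C, map_one]
    exact Polynomial.irreducible_X_sub_C 1
  have hmap1 : (Polynomial.X - Polynomial.C (1 : ℤ)).map (Int.castRingHom ℂ) = Polynomial.X - Polynomial.C 1 := by
    rw [Polynomial.map_sub, Polynomial.map_X, Polynomial.map_C, map_one]
  have hroot1 : ((Polynomial.X - Polynomial.C (1 : ℤ)).map (Int.castRingHom ℂ)).IsRoot 1 := by
    rw [hmap1, Polynomial.IsRoot.def, Polynomial.eval_sub, Polynomial.eval_X, Polynomial.eval_C, sub_self]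
  have hrootC : ∀ z : ℂ, ((Polynomial.X - Polynomial.C (1 : ℤ)).map (Int.castRingHom ℂ)).IsRoot z →
      (Polynomial.C a).eval z ≠ 0 ∧ (Polynomial.C b).eval z ≠ 0 := fun z _ ↦ by
    rw [Polynomial.eval_C, Polynomial.eval_C]; exact ⟨ha, hb⟩
  have hψQ : Polynomial.eval₂ (Int.castRingHom (CategoryTheory.End A)) (𝟙 A : CategoryTheory.End A)
      (Polynomial.X - Polynomial.C 1) = 0 := by
    rw [Polynomial.eval₂_sub, Polynomial.eval₂_X, Polynomial.eval₂_C, map_one]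
    exact sub_self _
  have hα2' : pullbackOne A α * pullbackOne A α = aeval (pullbackOne A (𝟙 A)) (Polynomial.C a) := by
    rw [h1, Polynomial.aeval_C, Algebra.algebraMap_eq_smul_one]; exact hα2
  have hβ2' : pullbackOne A β * pullbackOne A β = aeval (pullbackOne A (𝟙 A)) (Polynomial.C b) := by
    rw [h1, Polynomial.aeval_C, Algebra.algebraMap_eq_smul_one]; exact hβ2
  -- a complex root of `P`
  have he : 0 < e := Nat.pos_of_ne_zero fun h0 ↦ by
    rw [h0, zero_mul] at her
    have h2 : (n + 1) * A.dim = 0 := by omega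
    rcases Nat.mul_eq_zero.1 h2 with h3 | h3 <;> omega
  obtain ⟨ρ, hρ'⟩ : ∃ ρ : ℂ, (P.map (Int.castRingHom ℂ)).IsRoot ρ := by
    refine IsAlgClosed.exists_root _ fun h0 ↦ ?_
    rw [Polynomial.degree_eq_natDegree (hPm.map _).ne_zero, hPm.natDegree_map, hPe] at h0
    exact he.ne' (by exact_mod_cast h0)
  have hρ : Polynomial.eval₂ (Int.castRingHom ℂ) ρ P = 0 := by
    rwa [Polynomial.IsRoot.def, Polynomial.eval_map] at hρ'
  -- the exponent at the single place `z = 1`: `2 · 2m = l · 2 dim A`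
  obtain ⟨l, hl⟩ := exists_two_mul_finrank_eq_mul_of_mem_adjoin_definiteQuaternionOver_diagonal (n := n) (ψ := 𝟙 A)
    (Q := Polynomial.X - Polynomial.C 1) (qa := Polynomial.C a) (qb := Polynomial.C b) hA hh htop hnd
    (fun v w ↦ by rw [h1, Module.End.one_apply, Module.End.one_apply]) hQm hQirr hψQ hα2' (fun z hz ↦ (hrootC z hz).1)
    hβ2' (fun z hz ↦ (hrootC z hz).2) hanti hαskew hβskew (by rw [h1, one_mul, mul_one]) (by rw [h1, one_mul, mul_one])
    (Algebra.adjoin_mono (Set.subset_insert _ _) (hEnd φ)) ρ hroot1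
  have hl' := hl
  have htopA : (pullbackOne A (𝟙 A)).eigenspace 1 = ⊤ := by
    rw [eq_top_iff]
    intro v _
    rw [Module.End.mem_eigenspace_iff, h1, Module.End.one_apply, one_smul]
  have htopX : (pullbackOne (⨁ (fun _ : Fin (n + 1) => A)) (biproduct.map fun _ : Fin (n + 1) => 𝟙 A)).eigenspace 1 = ⊤ := by
    rw [eq_top_iff]
    intro v _
    rw [Module.End.mem_eigenspace_iff, hT1, Module.End.one_apply, one_smul]
  rw [htopA, htopX, inf_top_eq, finrank_top, AbelianVariety.finrank_complexBetti_one,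
    finrank_eigenspace_eq_of_root hPm hPe hPirr hφ herX hρ] at hl'
  -- `l` is odd, since `dim A ∤ m`
  obtain ⟨j, hj | hj⟩ := Nat.even_or_odd' l
  · exact absurd ⟨j, Nat.eq_of_mul_eq_mul_left (show 0 < 4 by norm_num) (by rw [hj] at hl'; linarith)⟩ hndvd
  · exact weilClassesField_biproduct_inf_divisorClassesSpan_eq_bot_of_forall_mem_adjoin_definiteQuaternionOver_diagonal_of_odd
      (ψ := 𝟙 A) (Q := Polynomial.X - Polynomial.C 1) (qa := Polynomial.C a) (qb := Polynomial.C b) hA hh htop hnd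
      (fun v w ↦ by rw [h1, Module.End.one_apply, Module.End.one_apply]) hQm hQirr hψQ hα2' (fun z hz ↦ (hrootC z hz).1)
      hβ2' (fun z hz ↦ (hrootC z hz).2) hanti hαskew hβskew (by rw [h1, one_mul, mul_one]) (by rw [h1, one_mul, mul_one])
      hPm hPe hPirr hφ her (fun χ ↦ Algebra.adjoin_mono (Set.subset_insert _ _) (hEnd χ))
      ⟨ρ, hρ, 1, hroot1, j, by rw [hl, hj]⟩

/-- **TYPE 3 OVER `ℚ` ON POWERS, THE DICHOTOMY: `W_F ⊗ ℂ ≤ 𝒟ᵐ ⊗ ℂ ↔ dim A ∣ m`** («`2m′/[F:ℚ]` even», `E = ℚ`), under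
«`End⁰(X) = M_{n+1}(D)`» («⟸» is the seat's
`weilClassesField_biproduct_le_divisorClassesSpan_of_mem_adjoin_definiteQuaternion_diagonal_of_dvd`).
[cite: MoonenZarhin1998WeilClasses, §1 Criterion (2), case «Type 3, m ≥ 2» with E = ℚ, and its proof (chunk p0003 L46–L60, L92–L111)]
[cite: Milne1999LefschetzClasses, §1 p. 643, Thm. 3.2, Cor. 4.5] -/
theorem weilClassesField_biproduct_le_divisorClassesSpan_iff_dvd_of_forall_mem_adjoin_definiteQuaternion_diagonal
    (hA : 0 < A.dim) (hh : h ∈ hodgeClassSpan A.dim A.X 1) (htop : lefschetzPow h (A.dim - 1) 2 h ≠ 0)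
    (hnd : ∀ x : complexBetti A.X 1, (∀ y, polarizationPairingOne A.X h (A.dim - 1) x y = 0) → x = 0)
    (ha : a ≠ 0) (hα2 : pullbackOne A α * pullbackOne A α = a • 1)
    (hb : b ≠ 0) (hβ2 : pullbackOne A β * pullbackOne A β = b • 1)
    (hanti : pullbackOne A α * pullbackOne A β = -(pullbackOne A β * pullbackOne A α))
    (hαskew : ∀ v w : complexBetti A.X 1, polarizationPairingOne A.X h (A.dim - 1) (pullbackOne A α v) w =
      -polarizationPairingOne A.X h (A.dim - 1) v (pullbackOne A α w))
    (hβskew : ∀ v w : complexBetti A.X 1, polarizationPairingOne A.X h (A.dim - 1) (pullbackOne A β v) w =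
      -polarizationPairingOne A.X h (A.dim - 1) v (pullbackOne A β w))
    (hPm : P.Monic) (hPe : P.natDegree = e) (hPirr : Irreducible (P.map (Int.castRingHom ℚ)))
    (hφ : Polynomial.eval₂ (Int.castRingHom (CategoryTheory.End (⨁ (fun _ : Fin (n + 1) => A))))
      (φ : CategoryTheory.End (⨁ (fun _ : Fin (n + 1) => A))) P = 0)
    (her : e * (2 * m) = 2 * ((n + 1) * A.dim))
    (hEnd : ∀ χ : (⨁ (fun _ : Fin (n + 1) => A)) ⟶ (⨁ (fun _ : Fin (n + 1) => A)), pullbackOne (⨁ (fun _ : Fin (n + 1) => A)) χ ∈ Algebra.adjoin ℂ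
      (insert (pullbackOne (⨁ (fun _ : Fin (n + 1) => A)) (biproduct.map fun _ : Fin (n + 1) => α))
        (insert (pullbackOne (⨁ (fun _ : Fin (n + 1) => A)) (biproduct.map fun _ : Fin (n + 1) => β))
          (Set.range fun ab : Fin (n + 1) × Fin (n + 1) ↦ pullbackOne (⨁ (fun _ : Fin (n + 1) => A))
            (biproduct.π (fun _ : Fin (n + 1) => A) ab.1 ≫ biproduct.ι (fun _ : Fin (n + 1) => A) ab.2))))) :
    weilClassesField (⨁ (fun _ : Fin (n + 1) => A)) φ P (2 * m) ≤
      divisorClassesSpan (⨁ (fun _ : Fin (n + 1) => A)).X (⨁ (fun _ : Fin (n + 1) => A)).dim m ↔ A.dim ∣ m := by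
  refine ⟨fun hle ↦ ?_, fun hdvd ↦
    weilClassesField_biproduct_le_divisorClassesSpan_of_mem_adjoin_definiteQuaternion_diagonal_of_dvd hA hh htop hnd ha hα2
      hb hβ2 hanti hαskew hβskew hPm hPe hPirr hφ her (hEnd φ) hdvd⟩
  by_contra hndvd
  have herX : e * (2 * m) = 2 * (⨁ (fun _ : Fin (n + 1) => A)).dim := by rw [dim_biproduct_const_succ A n, her]
  have hbot :=
    weilClassesField_biproduct_inf_divisorClassesSpan_eq_bot_of_forall_mem_adjoin_definiteQuaternion_diagonal_of_not_dvd
      hA hh htop hnd ha hα2 hb hβ2 hanti hαskew hβskew hPm hPe hPirr hφ her hEnd hndvd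
  obtain ⟨γ, hγW, -, hγ0⟩ := exists_isRationalClass_ne_zero_mem_weilClassesField hPm hPe hPirr hφ herX
  have h0 : γ ∈ weilClassesField (⨁ (fun _ : Fin (n + 1) => A)) φ P (2 * m) ⊓
      divisorClassesSpan (⨁ (fun _ : Fin (n + 1) => A)).X (⨁ (fun _ : Fin (n + 1) => A)).dim m := ⟨hγW, hle hγW⟩
  rw [hbot, Submodule.mem_bot] at h0
  exact hγ0 h0

/-- **… and `W_F ⊗ ℂ ⊓ 𝒟ᵐ ⊗ ℂ = ⊥ ↔ dim A ∤ m`** («`2m′/[F:ℚ]` odd», `E = ℚ`).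
[cite: MoonenZarhin1998WeilClasses, §1 Criterion (2), case «Type 3, m ≥ 2, 2m·[E:ℚ]/[F:ℚ] odd» with E = ℚ (chunk p0003 L46–L60, L92–L111)]
[cite: Milne1999LefschetzClasses, §1 p. 643, Thm. 3.2, Cor. 4.5] -/
theorem weilClassesField_biproduct_inf_divisorClassesSpan_eq_bot_iff_not_dvd_of_forall_mem_adjoin_definiteQuaternion_diagonal
    (hA : 0 < A.dim) (hh : h ∈ hodgeClassSpan A.dim A.X 1) (htop : lefschetzPow h (A.dim - 1) 2 h ≠ 0)
    (hnd : ∀ x : complexBetti A.X 1, (∀ y, polarizationPairingOne A.X h (A.dim - 1) x y = 0) → x = 0)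
    (ha : a ≠ 0) (hα2 : pullbackOne A α * pullbackOne A α = a • 1)
    (hb : b ≠ 0) (hβ2 : pullbackOne A β * pullbackOne A β = b • 1)
    (hanti : pullbackOne A α * pullbackOne A β = -(pullbackOne A β * pullbackOne A α))
    (hαskew : ∀ v w : complexBetti A.X 1, polarizationPairingOne A.X h (A.dim - 1) (pullbackOne A α v) w =
      -polarizationPairingOne A.X h (A.dim - 1) v (pullbackOne A α w))
    (hβskew : ∀ v w : complexBetti A.X 1, polarizationPairingOne A.X h (A.dim - 1) (pullbackOne A β v) w =
      -polarizationPairingOne A.X h (A.dim - 1) v (pullbackOne A β w))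
    (hPm : P.Monic) (hPe : P.natDegree = e) (hPirr : Irreducible (P.map (Int.castRingHom ℚ)))
    (hφ : Polynomial.eval₂ (Int.castRingHom (CategoryTheory.End (⨁ (fun _ : Fin (n + 1) => A))))
      (φ : CategoryTheory.End (⨁ (fun _ : Fin (n + 1) => A))) P = 0)
    (her : e * (2 * m) = 2 * ((n + 1) * A.dim))
    (hEnd : ∀ χ : (⨁ (fun _ : Fin (n + 1) => A)) ⟶ (⨁ (fun _ : Fin (n + 1) => A)), pullbackOne (⨁ (fun _ : Fin (n + 1) => A)) χ ∈ Algebra.adjoin ℂ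
      (insert (pullbackOne (⨁ (fun _ : Fin (n + 1) => A)) (biproduct.map fun _ : Fin (n + 1) => α))
        (insert (pullbackOne (⨁ (fun _ : Fin (n + 1) => A)) (biproduct.map fun _ : Fin (n + 1) => β))
          (Set.range fun ab : Fin (n + 1) × Fin (n + 1) ↦ pullbackOne (⨁ (fun _ : Fin (n + 1) => A))
            (biproduct.π (fun _ : Fin (n + 1) => A) ab.1 ≫ biproduct.ι (fun _ : Fin (n + 1) => A) ab.2))))) :
    weilClassesField (⨁ (fun _ : Fin (n + 1) => A)) φ P (2 * m) ⊓
      divisorClassesSpan (⨁ (fun _ : Fin (n + 1) => A)).X (⨁ (fun _ : Fin (n + 1) => A)).dim m = ⊥ ↔ ¬ A.dim ∣ m := by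
  refine ⟨fun hbot hdvd ↦ ?_,
    weilClassesField_biproduct_inf_divisorClassesSpan_eq_bot_of_forall_mem_adjoin_definiteQuaternion_diagonal_of_not_dvd
      hA hh htop hnd ha hα2 hb hβ2 hanti hαskew hβskew hPm hPe hPirr hφ her hEnd⟩
  have herX : e * (2 * m) = 2 * (⨁ (fun _ : Fin (n + 1) => A)).dim := by rw [dim_biproduct_const_succ A n, her]
  have hle := weilClassesField_biproduct_le_divisorClassesSpan_of_mem_adjoin_definiteQuaternion_diagonal_of_dvd hA hh htop
    hnd ha hα2 hb hβ2 hanti hαskew hβskew hPm hPe hPirr hφ her (hEnd φ) hdvd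
  obtain ⟨γ, hγW, -, hγ0⟩ := exists_isRationalClass_ne_zero_mem_weilClassesField hPm hPe hPirr hφ herX
  have h0 : γ ∈ weilClassesField (⨁ (fun _ : Fin (n + 1) => A)) φ P (2 * m) ⊓
      divisorClassesSpan (⨁ (fun _ : Fin (n + 1) => A)).X (⨁ (fun _ : Fin (n + 1) => A)).dim m := ⟨hγW, hle hγW⟩
  rw [hbot, Submodule.mem_bot] at h0
  exact hγ0 h0

end DefiniteQuaternionOverRat

end Literature.AlgebraicGeometry.HodgeTheory

end
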